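import Mathlib
import Literature.Combinatorics.Optimization.SheraliAdamsRandomRestriction
import Literature.Computability.Complexity.ApproximateDegreeDuality
import Literature.Computability.Complexity.FourierDegreeAlgebra
import HarnessLib

/-!
# Kothari–Meka–Raghavendra 2017, §4.2: an approximate conical junta becomes an exact conical junta after a
# shift by `1/n` (Lemma 2.4, with Lemmas 4.1–4.3) — PROVED

Source: P. K. Kothari, R. Meka, P. Raghavendra, *Approximating rectangles by juntas and weakly-exponential
lower bounds for LP relaxations of CSPs*, STOC 2017; journal version SIAM J. Comput. (doi:10.1137/17M1152966);
arXiv:1610.02704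
[KothariMekaRaghavendra2017]; held text `paper:arxiv-1610.02704` (the arXiv source, read first-hand
2026-08-28; locators below are its sections/numbers: Def. 2.1, Def. 2.2, Lemma 2.3, Lemma 2.4 in §2.1;
"Proof of Theorem 1.10" at the head of §4; Lemmas 4.1, 4.2, 4.3 and "Proof of Lemma 2.4" in §4.2).

CONTEXT. The tree types Theorem 1.10 of the paper ("`nnr(M_f^b) ≥ 2^{c·b·(deg_+(f+η) − 8 deg f)}`") as the
named fact `KothariMekaRaghavendra2017_thm110` (`LPRelaxationsMaxCSP.lean`); everything downstream of it
(Theorem 1.2, Corollary 1.5 for MAX-3SAT / MAX-3XOR / MAX-CUT, the generic `lpGap_of_SAgap`) is PROVED from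
that one fact. In print Theorem 1.10 is "Lemma 2.3 + Lemma 2.4" (§4, first paragraph: "`lem:approx-conical`
and `lem:approx-to-exact` together immediately imply `thm:nnrlift`"): Lemma 2.3 (every `f` with small
`nnr(M_f^b)` is an approximate conical junta — the junta-approximation theorem for rectangles, §4.1 + §5 +
§6) and Lemma 2.4 (an approximate conical junta is, after adding `1/n`, an exact conical junta of
proportional degree — §4.2). THIS FILE PROVES LEMMA 2.4 with the definitions it needs; Lemma 2.3 is not
touched (no new named fact is introduced).

THE PRINTED STATEMENTS (arXiv source, verbatim up to notation).
* Def. 2.1: "For `0 < ε < 1`, a function `h : {−1,1}ⁿ → ℝ` is said to be `ε`-decaying if `E[h] = 0` and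
  for every `I ⊆ [n]`, `|ĥ(I)| ≤ ε^{|I|}`." — `IsDecaying ε h`.
* §2.1: "A Boolean conjunction `C : {−1,1}ⁿ → ℝ_{≥0}` is defined by a subset `I ⊆ [n]` of variables and
  `α` an assignment to the variables in `I` by `C(x) = 2^{|I|} · 𝟙[x_I = α]`. We say `C` is a
  `d`-conjunction if `|I| ≤ d`. Observe that … `E[C] = 1`." — `conjunction I α`, `IsConjunction d C`,
  `cubeExpect_conjunction`.
* Def. 2.2: "a function `f : {−1,1}ⁿ → ℝ_{≥0}` with `E[f] = 1` is said to be an `(ε,δ)`-approximate conical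
  `d`-junta if `f` can be written as `f(z) = Σ_{i∈[N]} λ_i C_i(z)·(1 + h_i(z)) + γ(z)` for `d`-conjunctions
  `C_1,…,C_N`, `ε`-decaying functions `h_1,…,h_N`, `λ_1,…,λ_N ∈ ℝ_{≥0}` with `Σ_i λ_i ≤ 1`, and a function
  `γ : {−1,1}ⁿ → ℝ_{≥0}` such that `E[γ] ≤ δ`." — `IsApproxConicalJunta ε δ d f` (the representation
  itself; the paper reserves the name for densities, and uses it in Lemma 2.4 with `E[f] ≤ 1`).
* **Lemma 2.4.** "Suppose `f : {−1,1}ⁿ → ℝ_{≥0}` with `E[f] ≤ 1` is an `(ε,δ)`-approximate conical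
  `d`-junta for `ε < 1/n⁴` and some `d ≥ deg(f)` and `δ < 1/n^{8d}` then `deg_+(f + 1/n) ≤ 8d`." —
  `KothariMekaRaghavendra2017_lemma24` (with `deg f ≤ d` as `cubeDegree f ≤ d`; `deg_+` = `nonnegDegree`).
* Lemma 4.1 (separating functional): "Suppose `deg(f) ≤ D < deg_+(f+η)`. There exists a degree `D` function
  `𝓛` such that `E[𝓛] = 1`, `E[𝓛 f] < −η`, `E[𝓛 h] ≥ 0` for every conical `D`-junta `h`, `|𝓛̂(S)| ≤ 1`
  for every `|S| ≤ D`, `‖𝓛‖_∞ ≤ n^D`."  Lemma 4.2: for a non-negative junta `h` on `T` and `|S| + |T| ≤ D`,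
  "`E[𝓛 h χ_S] ≤ E[𝓛 h]`".  Lemma 4.3: for `D = 4d`, a non-negative `d`-junta `c` and a `(1/n⁴)`-decaying
  `h`, "`E[𝓛 c (1+h)] ≥ −n^{−8d}`".

HOW IT IS PROVED HERE (the printed proof, in the tree's functional currency). The "degree-`D` separating
function `𝓛`" of Lemma 4.1 is rendered as a degree-`D` Sherali–Adams pseudoexpectation (the tree's
`SAPseudoexpectation n D`: a linear functional `Ẽ` with `Ẽ[1] = 1` and `Ẽ ≥ 0` on non-negative `D`-juntas)
composed with the Fourier truncation to levels `≤ D` (the tree's `SAPseudoexpectation.truncate`, file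
`SheraliAdamsRandomRestriction.lean`) — i.e. `Ẽ[g] = E[𝓛 g]`; its existence when `f + η` is not a conical
`D`-junta (`exists_lt_of_not_isConicalJunta`) is the tree's LP duality
`SAPseudoexpectation.forall_le_iff_isConicalJunta` (= the paper's Fact 3.4), which replaces the hyperplane
separation of the printed proof; `|Ẽ[χ_S]| ≤ 1` (`|S| ≤ D`) is the tree's `abs_E_walsh_le_one`; the use of
`‖𝓛‖_∞ ≤ n^D` is replaced by `|Ẽ_trunc[g]| ≤ #{S : |S| ≤ D} · E|g|` (`abs_truncate_E_le_mul_card` of the tree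
with `|ĝ(S)| ≤ E|g|`), and `#{S : |S| ≤ D} ≤ 1 + n^D` is the tree's `sum_range_choose_le_one_add_pow`.
Lemma 4.2 is `SAPseudoexpectation.abs_E_junta_mul_walsh_le` (both signs: `c(1 ± χ_S) ≥ 0` is a `D`-junta).
Lemma 4.3 is `SAPseudoexpectation.truncate_E_conjunction_mul_ge`: writing `h = Σ_S ĥ(S) χ_S` and splitting at
`|S| ≤ 3d` exactly as printed, the low part is `≥ −E[𝓛c]·Σ_{S≠∅} ε^{|S|}` by Lemma 4.2 and the high part is
`≥ −#{S : |S| ≤ 4d} · Σ_{|S|>3d} ε^{|S|}` (here `E[c] = 1`); the two tail sums are bounded by one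
regrouping-by-level estimate `Σ_{|S| ≥ m} ε^{|S|} ≤ Σ_{j ≥ m} C(n,j) ε^j ≤ 2 (nε)^m` (`sum_pow_card_filter_le`,
for `nε ≤ 1/2`). The final contradiction ("Proof of Lemma 2.4") is `Ẽ[f] < −1/n` against
`Ẽ[f] = Σ λ_i Ẽ[c_i(1+h_i)] + Ẽ[γ] ≥ −#{S : |S| ≤ 4d}·(2(nε)^{3d+1} + δ) > −1/n`.

HONEST NOTES (recorded, statement of the named result unchanged).
(1) The printed proof takes `D = 4d` in Lemma 4.1 and contradicts `D < deg_+(f + 1/n)`, so it proves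
`deg_+(f + 1/n) ≤ 4d`; the lemma is printed with `8d`. We prove the `4d` form
(`nonnegDegree_add_inv_le_of_isApproxConicalJunta`) and derive the printed `8d` form from it
(`KothariMekaRaghavendra2017_lemma24`). (2) The hypothesis "`E[f] ≤ 1`" of Lemma 2.4 is not used by the
printed proof and is omitted (a stronger theorem). (3) Small `n`: the printed constants ("`εn = 1/n³ < 1/2`",
"`‖𝓛‖_∞ ≤ n^D`") presuppose `n` moderately large; here the case `n ≤ 4d` is settled directly (`deg_+ g ≤ n`
for every `g ≥ 0`, the tree's `nonnegDegree_le`) and the estimates are run for `n ≥ 4d + 1 ≥ 5`, where the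
error is `≤ 3·n^{−4d} < 1/n`; the theorem holds for every `n` and every `d` (for `d = 0`, `deg f ≤ 0` makes
`f` constant). (4) `ε ≥ 0` is assumed (printed: `0 < ε < 1`).

APPENDED (v2, same seat; all PROVED, for the use of §4.1 / "Proof of Theorem 1.10" in
`NonnegativeRankConicalJuntas.lean`). (a) Closure properties of the representation of Def. 2.2 that §4.1 uses
tacitly: weakening `ε, δ, d` (`IsApproxConicalJunta.mono`, `.degree_mono`), scaling by `s ∈ [0,1]` (`.smul`),
absorbing a non-negative function of small mean into the error (`.add_error`), and sub-convex combinations of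
finitely many representations (`isApproxConicalJunta_sum`, re-indexed along `Fintype.equivFin` by
`isApproxConicalJunta_of_fintype`). (b) **Lemma 2.4 with the shift `1/(2n)`**
(`isConicalJunta_add_of_isApproxConicalJunta`: under the printed hypotheses `f + η` is a conical `4d`-junta for
EVERY `η ≥ 1/(2n)`) — the same proof, the factor-2 slack of note (3) made explicit
(`KMR_lemma24_arith_half`: the error is `< 1/(2n)`). (c) Product reweightings `ρ_c(z) = Π_i (1 + c·(−1)^{z_i})`
(`biasProd`; Walsh expansion `Σ_U c^{|U|} χ_U`, `ρ_c ρ_{−c} = (1−c²)ⁿ`, two-sided bounds) and the lemma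
`exists_isDecaying_one_add_mul_biasProd`: for `h` `ε`-decaying and `|c| ≤ κ`, `(1+h)ρ_c = a(1+h')` with
`a ∈ [1−τ, 1+τ]`, `τ = (1+κε)ⁿ − 1`, and `h'` `ε'`-decaying, `ε' = (κ+ε)(1+κε)ⁿ/(1−τ)` (coefficientwise
`((1+h)ρ_c)^(S) = Σ_T (1+h)^(T) c^{|T∆S|}` and `Σ_T ε^{|T|}κ^{|T∆S|} = (κ+ε)^{|S|}(1+κε)^{n−|S|}`), whence
`IsApproxConicalJunta.mul_biasProd`. Item (c) is NOT in the paper: it is the bookkeeping that replaces the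
sentence "`𝟙_z` is a density" of §4.1 — true for a balanced gadget, which the paper intends ("a slightly
modified (in order to ensure balancedness) version of the inner-product function", §1.2) but which the
literal formula of Def. 1.7, `IP(x,y) = (−1)^{x_1⊕y_1}·(−1)^{⊕_{i=1}^b x_i y_i}` = the tree's `ipGadget`, is
not (`P[IP = −1] = 1/2 − 2^{−(b+1)}`); for the literal gadget the uniform fibre density is the product
weight `ρ_κ`, `κ = 1/(2^b − 1)`, and (b)+(c) absorb the resulting `(1 ± O(n/2^b))`-factors.

What this is NOT: not Lemma 2.3 / Theorem 1.10 (the junta approximation of high-min-entropy rectangles, §5–§6,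
is the remaining unproved half of `KothariMekaRaghavendra2017_thm110`); nothing here is specific to CSPs or
pattern matrices; no P-vs-NP content. Consumer: cell pnp-psdrank (summit PneNP), row (5) of the
literature-typing layer (LRS 2015 / KMR 2017). No instances, no notation, standard axioms.
-/

noncomputable section

open Finset
open Literature.Probability.RandomGraphs.LowDegree (walsh sgn walsh_empty)
open Literature.Computability.Complexity.LowDegree (cubeFourierCoeff sum_cubeFourierCoeff_mul_walsh
  cubeFourierCoeff_empty)
open Literature.Computability.Complexity.ApproximateDegree (hasDegreeLE_card)

namespace Literature.Combinatorics.Optimization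

variable {n : ℕ}

/-! ### Definitions 2.1 and 2.2: decaying functions, conjunctions, approximate conical juntas -/

/-- **`ε`-decaying functions** (KMR Def. 2.1): `E[h] = 0` and `|ĥ(S)| ≤ ε^{|S|}` for every `S ⊆ [n]`
(Fourier–Walsh coefficients for the uniform measure, `ĥ(S) = E_x h(x) χ_S(x)`).
[cite: KothariMekaRaghavendra2017, Def. 2.1 (§2.1)] -/
def IsDecaying (ε : ℝ) (h : (Fin n → Bool) → ℝ) : Prop :=
  cubeExpect h = 0 ∧ ∀ S : Finset (Fin n), |cubeFourierCoeff h S| ≤ ε ^ S.card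

/-- **The Boolean conjunction** `C_{I,α}(x) = 2^{|I|} · 𝟙[x_I = α_I]` (normalised so that `E[C] = 1`).
[cite: KothariMekaRaghavendra2017, §2.1 (notation before Def. 2.1)] -/
def conjunction (I : Finset (Fin n)) (α : Fin n → Bool) : (Fin n → Bool) → ℝ :=
  fun x => if ∀ i ∈ I, x i = α i then (2 : ℝ) ^ I.card else 0

/-- `C` is a **`d`-conjunction**: `C = C_{I,α}` for some `|I| ≤ d`.
[cite: KothariMekaRaghavendra2017, §2.1 ("We say C is a d-conjunction if |I| ≤ d")] -/
def IsConjunction (d : ℕ) (C : (Fin n → Bool) → ℝ) : Prop :=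
  ∃ (I : Finset (Fin n)) (α : Fin n → Bool), I.card ≤ d ∧ C = conjunction I α

/-- **`(ε,δ)`-approximate conical `d`-junta** (KMR Def. 2.2): `f = Σ_i λ_i C_i (1 + h_i) + γ` with
`d`-conjunctions `C_i`, `ε`-decaying `h_i`, `λ_i ≥ 0`, `Σ λ_i ≤ 1`, and `γ ≥ 0` with `E[γ] ≤ δ` (the
multiplicative errors `h_i` and the additive error `γ`). The representation is what is recorded; the paper
uses the name for densities `f ≥ 0`, `E f = 1` (and in Lemma 2.4 for `E f ≤ 1`).
[cite: KothariMekaRaghavendra2017, Def. 2.2 (§2.1, eq. (2.1))] -/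
def IsApproxConicalJunta (ε δ : ℝ) (d : ℕ) (f : (Fin n → Bool) → ℝ) : Prop :=
  ∃ (N : ℕ) (lam : Fin N → ℝ) (C h : Fin N → (Fin n → Bool) → ℝ) (γ : (Fin n → Bool) → ℝ),
    (∀ i, 0 ≤ lam i) ∧ ∑ i, lam i ≤ 1 ∧ (∀ i, IsConjunction d (C i)) ∧ (∀ i, IsDecaying ε (h i)) ∧
    (∀ x, 0 ≤ γ x) ∧ cubeExpect γ ≤ δ ∧
    ∀ x, f x = ∑ i, lam i * (C i x * (1 + h i x)) + γ x

/-! ### Conjunctions: non-negativity, junta property, `E[C] = 1` -/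

/-- Conjunctions are non-negative. [cite: KothariMekaRaghavendra2017, §2.1 ("C : {−1,1}ⁿ → ℝ_{≥0}")] -/
theorem conjunction_nonneg (I : Finset (Fin n)) (α : Fin n → Bool) (x : Fin n → Bool) :
    0 ≤ conjunction I α x := by
  unfold conjunction
  split_ifs <;> positivity

/-- A conjunction on `I` only reads the coordinates in `I`. [cite: KothariMekaRaghavendra2017, §2.1] -/
theorem conjunction_congr (I : Finset (Fin n)) (α : Fin n → Bool) {x y : Fin n → Bool}
    (hxy : ∀ i ∈ I, x i = y i) : conjunction I α x = conjunction I α y := by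
  unfold conjunction
  by_cases hx : ∀ i ∈ I, x i = α i
  · have hy : ∀ i ∈ I, y i = α i := fun i hi => (hxy i hi).symm.trans (hx i hi)
    rw [if_pos hx, if_pos hy]
  · have hy : ¬ ∀ i ∈ I, y i = α i := fun hy => hx fun i hi => (hxy i hi).trans (hy i hi)
    rw [if_neg hx, if_neg hy]

/-- A conjunction on `I` is an `|I|`-junta. [cite: KothariMekaRaghavendra2017, §2.1 (d-conjunctions are d-juntas)] -/
theorem isJunta_conjunction (I : Finset (Fin n)) (α : Fin n → Bool) :
    IsJunta I.card (conjunction I α) :=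
  ⟨I, le_rfl, fun _ _ hxy => conjunction_congr I α hxy⟩

/-- `Σ_x C_{I,α}(x) = 2ⁿ`: the `2^{n−|I|}` points of the subcube, each weighted `2^{|I|}`.
[cite: KothariMekaRaghavendra2017, §2.1 ("E[C] = 1")] -/
theorem sum_conjunction (I : Finset (Fin n)) (α : Fin n → Bool) :
    ∑ x, conjunction I α x = (2 : ℝ) ^ n := by
  classical
  -- the conjunction as a product of one-coordinate factors
  have hpt : ∀ x : Fin n → Bool, conjunction I α x =
      ∏ i, (if i ∈ I then (if x i = α i then (2 : ℝ) else 0) else 1) := by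
    intro x
    rw [Finset.prod_ite_mem, Finset.univ_inter]
    have h2 : ∀ i ∈ I, (if x i = α i then (2 : ℝ) else 0) = 2 * (if x i = α i then 1 else 0) :=
      fun i _ => by split_ifs <;> norm_num
    rw [Finset.prod_congr rfl h2, Finset.prod_mul_distrib, Finset.prod_const, Finset.prod_boole]
    unfold conjunction
    split_ifs <;> simp
  have h := Finset.prod_univ_sum (fun _ : Fin n => (Finset.univ : Finset Bool))
    (fun i b => (if i ∈ I then (if b = α i then (2 : ℝ) else 0) else 1))
  rw [Fintype.piFinset_univ] at h
  simp_rw [hpt]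
  rw [← h]
  have hfac : ∀ i : Fin n, ∑ b : Bool, (if i ∈ I then (if b = α i then (2 : ℝ) else 0) else 1) = 2 := by
    intro i
    rw [Fintype.sum_bool]
    by_cases hi : i ∈ I
    · simp only [hi, if_true]
      cases α i <;> simp
    · simp only [hi, if_false]
      norm_num
  rw [Finset.prod_congr rfl (fun i _ => hfac i), Finset.prod_const, Finset.card_univ, Fintype.card_fin]

/-- **`E[C] = 1` for every conjunction.** [cite: KothariMekaRaghavendra2017, §2.1 ("Observe that we choose a non-standard scaling that satisfies E[C] = 1")] -/
theorem cubeExpect_conjunction (I : Finset (Fin n)) (α : Fin n → Bool) :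
    cubeExpect (conjunction I α) = 1 := by
  unfold cubeExpect
  rw [sum_conjunction]
  exact div_self (pow_ne_zero _ two_ne_zero)

/-- `E |C · χ_S| = E[C] = 1` (characters are `±1`-valued). [cite: KothariMekaRaghavendra2017, §4.2 (proof of Lemma 4.3)] -/
theorem cubeExpect_abs_conjunction_mul_walsh (I : Finset (Fin n)) (α : Fin n → Bool)
    (S : Finset (Fin n)) :
    cubeExpect (fun x => |conjunction I α x * walsh S x|) = 1 := by
  have : (fun x => |conjunction I α x * walsh S x|) = conjunction I α := by
    funext x
    rw [abs_mul, abs_walsh, mul_one, abs_of_nonneg (conjunction_nonneg I α x)]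
  rw [this, cubeExpect_conjunction]

/-! ### Degree bookkeeping: `deg f ≤ d` as `HasDegreeLE`, constants, conical juntas -/

/-- `deg f` is attained: `f` has degree `≤ cubeDegree f` (every `f` has degree `≤ n`, the tree's
`ApproximateDegree.hasDegreeLE_card`). [cite: KothariMekaRaghavendra2017, Thm 1.10 ("deg(f), the degree of f")] -/
theorem hasDegreeLE_cubeDegree (f : (Fin n → Bool) → ℝ) : HasDegreeLE (cubeDegree f) f :=
  Nat.sInf_mem (s := {d | HasDegreeLE d f}) ⟨n, hasDegreeLE_card f⟩

/-- `cubeDegree f ≤ d ↔ HasDegreeLE d f` (the reading of the printed "`d ≥ deg(f)`").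
[cite: KothariMekaRaghavendra2017, Lemma 2.4 ("some d ≥ deg(f)")] -/
theorem cubeDegree_le_iff (f : (Fin n → Bool) → ℝ) (d : ℕ) : cubeDegree f ≤ d ↔ HasDegreeLE d f :=
  ⟨fun h => (hasDegreeLE_cubeDegree f).mono h, cubeDegree_le_of_hasDegreeLE⟩

/-- A function of degree `≤ 0` is constant (`= f̂(∅)`). [cite: KothariMekaRaghavendra2017, §3.3] -/
theorem eq_const_of_hasDegreeLE_zero {f : (Fin n → Bool) → ℝ} (hf : HasDegreeLE 0 f) (x : Fin n → Bool) :
    f x = cubeFourierCoeff f ∅ := by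
  classical
  have := congrFun (fourierTruncate_eq_self_of_hasDegreeLE hf) x
  rw [← this]
  unfold fourierTruncate
  rw [Finset.sum_eq_single (∅ : Finset (Fin n))]
  · rw [walsh_empty, mul_one]
  · intro S hS hSne
    exfalso
    rw [mem_filter] at hS
    exact hSne (Finset.card_eq_zero.1 (Nat.le_zero.1 hS.2))
  · intro h
    exfalso
    exact h (mem_filter.2 ⟨mem_univ _, by simp⟩)

/-- A non-negative constant is a conical `d`-junta for every `d`. [cite: KothariMekaRaghavendra2017, Def. 1.8 (p. 4)] -/
theorem isConicalJunta_const_of_nonneg (d : ℕ) {a : ℝ} (ha : 0 ≤ a) :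
    IsConicalJunta d (fun _ : Fin n → Bool => a) :=
  ⟨1, fun _ => a, fun _ _ => 1, fun _ => ha, fun _ => isJunta_const d 1, fun _ _ => zero_le_one,
    fun x => by simp⟩

/-! ### Lemma 4.1: the separating functional (via the tree's Sherali–Adams LP duality) -/

/-- **Lemma 4.1, existence of the separating functional**: if `g + η` is NOT a conical `D`-junta then some
degree-`D` Sherali–Adams pseudoexpectation `Ẽ` (a linear functional with `Ẽ[1] = 1` and `Ẽ ≥ 0` on
non-negative `D`-juntas, hence on conical `D`-juntas) has `Ẽ[g] < −η`. Printed via a separating hyperplane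
for the convex cone `𝒞_{≤D}`; here it is the contrapositive of the "⇒" half of the tree's LP duality
`SAPseudoexpectation.forall_le_iff_isConicalJunta` (applied to `−g` and `c = η`).
[cite: KothariMekaRaghavendra2017, Lemma 4.1 (§4.2)] -/
theorem exists_lt_of_not_isConicalJunta {D : ℕ} {g : (Fin n → Bool) → ℝ} {η : ℝ}
    (h : ¬ IsConicalJunta D (fun x => g x + η)) :
    ∃ pE : SAPseudoexpectation n D, pE.E g < -η := by
  by_contra hcon
  apply h
  have hall : ∀ pE : SAPseudoexpectation n D, pE.E (fun x => -g x) ≤ η := by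
    intro pE
    have h1 : ¬ pE.E g < -η := fun h' => hcon ⟨pE, h'⟩
    have hneg : pE.E (fun x => -g x) = -pE.E g := by
      rw [show (fun x => -g x) = -g from rfl, map_neg]
    rw [hneg]
    linarith [not_lt.1 h1]
  have key := (SAPseudoexpectation.forall_le_iff_isConicalJunta D (fun x => -g x) η).1 hall
  convert key using 2 with x
  ring

/-! ### Lemma 4.2: `|Ẽ[c χ_S]| ≤ Ẽ[c]` for a non-negative junta `c` on `T` with `|T ∪ S| ≤ D` -/

/-- **Lemma 4.2** (both signs): for a non-negative `c` depending only on the coordinates in `T`, and `S`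
with `|T ∪ S| ≤ D`, every degree-`D` Sherali–Adams pseudoexpectation satisfies `|Ẽ[c·χ_S]| ≤ Ẽ[c]` —
because `c (1 ± χ_S)` are non-negative `D`-juntas. (Printed: "`h(1 − χ_S)` is a non-negative `D`-junta.
Therefore `⟨𝓛, h(1−χ_S)⟩ ≥ 0`; the claim follows.") [cite: KothariMekaRaghavendra2017, Lemma 4.2 (§4.2)] -/
theorem SAPseudoexpectation.abs_E_junta_mul_walsh_le {D : ℕ} (pE : SAPseudoexpectation n D)
    {c : (Fin n → Bool) → ℝ} {T : Finset (Fin n)} (hc0 : ∀ x, 0 ≤ c x)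
    (hcT : ∀ x y : Fin n → Bool, (∀ i ∈ T, x i = y i) → c x = c y) (S : Finset (Fin n))
    (hTS : (T ∪ S).card ≤ D) :
    |pE.E (fun x => c x * walsh S x)| ≤ pE.E c := by
  have hj : ∀ s : ℝ, IsJunta D (fun x => c x * (1 + s * walsh S x)) := fun s =>
    ⟨T ∪ S, hTS, fun x y hxy => by
      have hc : c x = c y := hcT x y fun i hi => hxy i (Finset.mem_union_left S hi)
      have hw : walsh S x = walsh S y :=
        show walsh S x = walsh S y from prod_congr rfl fun i hi => by
          rw [hxy i (Finset.mem_union_right T hi)]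
      simp only [hc, hw]⟩
  have hnn : ∀ s : ℝ, |s| ≤ 1 → ∀ x, 0 ≤ c x * (1 + s * walsh S x) := by
    intro s hs x
    refine mul_nonneg (hc0 x) ?_
    have h1 : |s * walsh S x| ≤ 1 := by rw [abs_mul, abs_walsh, mul_one]; exact hs
    linarith [neg_abs_le (s * walsh S x)]
  have hlin : ∀ s : ℝ, pE.E (fun x => c x * (1 + s * walsh S x)) =
      pE.E c + s * pE.E (fun x => c x * walsh S x) := by
    intro s
    have : (fun x => c x * (1 + s * walsh S x)) = c + s • (fun x => c x * walsh S x) := by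
      funext x
      simp only [Pi.add_apply, Pi.smul_apply, smul_eq_mul]
      ring
    rw [this, map_add, map_smul, smul_eq_mul]
  have h1 := pE.nonneg _ (hj 1) (hnn 1 (by norm_num))
  have h2 := pE.nonneg _ (hj (-1)) (hnn (-1) (by norm_num))
  rw [hlin] at h1 h2
  rw [abs_le]
  constructor <;> linarith

/-! ### The truncated functional is bounded by `#{S : |S| ≤ D} · E|g|` (replaces `‖𝓛‖_∞ ≤ n^D`) -/

/-- `|ĝ(S)| ≤ E|g|` (`|χ_S| = 1`). [cite: KothariMekaRaghavendra2017, §4.2 (proof of Lemma 4.3, "‖𝓛 c‖_∞ · ‖h_high‖_∞")] -/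
theorem abs_cubeFourierCoeff_le_cubeExpect_abs (g : (Fin n → Bool) → ℝ) (S : Finset (Fin n)) :
    |cubeFourierCoeff g S| ≤ cubeExpect (fun x => |g x|) := by
  unfold Literature.Computability.Complexity.LowDegree.cubeFourierCoeff cubeExpect
  rw [abs_div, abs_of_pos (by positivity : (0 : ℝ) < 2 ^ n)]
  refine div_le_div_of_nonneg_right ?_ (by positivity)
  refine (Finset.abs_sum_le_sum_abs _ _).trans (Finset.sum_le_sum fun x _ => ?_)
  rw [abs_mul, abs_walsh, mul_one]

/-- **`|Ẽ_trunc[g]| ≤ E|g| · #{S : |S| ≤ D}`** for every degree-`D` Sherali–Adams pseudoexpectation (the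
tree's `abs_truncate_E_le_mul_card` with `|ĝ(S)| ≤ E|g|`); this is how the printed bound
`|E[𝓛 γ]| ≤ ‖𝓛‖_∞ E|γ|`, `‖𝓛‖_∞ ≤ Σ_{|S| ≤ D} |𝓛̂(S)|`, is used. [cite: KothariMekaRaghavendra2017, Lemma 4.1 (last bullet) and proof of Lemma 2.4 (§4.2)] -/
theorem SAPseudoexpectation.abs_truncate_E_le_cubeExpect_abs_mul_card {D : ℕ}
    (pE : SAPseudoexpectation n D) (g : (Fin n → Bool) → ℝ) :
    |pE.truncate.E g| ≤
      cubeExpect (fun x => |g x|) * (univ.filter (fun S : Finset (Fin n) => S.card ≤ D)).card :=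
  pE.abs_truncate_E_le_mul_card fun S _ => abs_cubeFourierCoeff_le_cubeExpect_abs g S

/-! ### Tail sums of `ε^{|S|}` by level -/

/-- `Σ_{j < K, j ≥ m} x^j ≤ 2 x^m` for `0 ≤ x ≤ 1/2` (geometric tail). [cite: KothariMekaRaghavendra2017, §4.2 (proof of Lemma 4.3: "Σ_{ℓ=D−d}^n ε^ℓ n^ℓ ≤ 2(εn)^{D−d}")] -/
theorem sum_range_ite_pow_le {x : ℝ} (hx0 : 0 ≤ x) (hx : x ≤ 1 / 2) (m K : ℕ) :
    ∑ j ∈ range K, (if m ≤ j then x ^ j else 0) ≤ 2 * x ^ m := by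
  by_cases hKm : K ≤ m
  · have h0 : ∑ j ∈ range K, (if m ≤ j then x ^ j else 0) = 0 :=
      sum_eq_zero fun j hj => if_neg (not_le.2 (lt_of_lt_of_le (mem_range.1 hj) hKm))
    rw [h0]
    positivity
  · have hmK : m ≤ K := le_of_lt (not_le.1 hKm)
    have key : ∀ K, m ≤ K →
        ∑ j ∈ range K, (if m ≤ j then x ^ j else 0) ≤ 2 * x ^ m - 2 * x ^ K := by
      intro K hK
      induction K, hK using Nat.le_induction with
      | base =>
        have h0 : ∑ j ∈ range m, (if m ≤ j then x ^ j else 0) = 0 :=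
          sum_eq_zero fun j hj => if_neg (not_le.2 (mem_range.1 hj))
        rw [h0]
        linarith
      | succ K hK ih =>
        rw [sum_range_succ, if_pos hK]
        have hxK : 0 ≤ x ^ K := pow_nonneg hx0 K
        have hsucc : x ^ (K + 1) = x ^ K * x := pow_succ x K
        have hprod : 0 ≤ x ^ K * (1 - 2 * x) := mul_nonneg hxK (by linarith)
        nlinarith
    have h1 := key K hmK
    have h2 : 0 ≤ x ^ K := pow_nonneg hx0 K
    linarith

/-- **Level tail bound**: for `0 ≤ ε` with `nε ≤ 1/2`, `Σ_{S ⊆ [n], |S| ≥ m} ε^{|S|} = Σ_{j ≥ m} C(n,j) ε^j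
≤ Σ_{j ≥ m} (nε)^j ≤ 2 (nε)^m`. Used with `m = 1` (`Σ_{S ≠ ∅} ε^{|S|} ≤ 2nε`, printed "`1 − 2Dnε`") and with
`m = 3d + 1` (printed "`‖h_high‖_∞ ≤ 2(εn)^{D−d}`"). [cite: KothariMekaRaghavendra2017, §4.2 (proof of Lemma 4.3)] -/
theorem sum_pow_card_filter_le (n m : ℕ) {ε : ℝ} (hε0 : 0 ≤ ε) (hnε : (n : ℝ) * ε ≤ 1 / 2) :
    ∑ S ∈ univ.filter (fun S : Finset (Fin n) => m ≤ S.card), ε ^ S.card ≤ 2 * ((n : ℝ) * ε) ^ m := by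
  classical
  have hreg : ∑ S ∈ univ.filter (fun S : Finset (Fin n) => m ≤ S.card), ε ^ S.card =
      ∑ j ∈ range (n + 1), (n.choose j : ℝ) * (if m ≤ j then ε ^ j else 0) := by
    rw [Finset.sum_filter]
    have h := Finset.sum_powerset_apply_card (fun j => if m ≤ j then ε ^ j else (0 : ℝ))
      (x := (univ : Finset (Fin n)))
    rw [Finset.powerset_univ, Finset.card_univ, Fintype.card_fin] at h
    rw [h]
    exact sum_congr rfl fun j _ => by rw [nsmul_eq_mul]
  rw [hreg]
  have hx0 : 0 ≤ (n : ℝ) * ε := by positivity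
  calc ∑ j ∈ range (n + 1), (n.choose j : ℝ) * (if m ≤ j then ε ^ j else 0)
      ≤ ∑ j ∈ range (n + 1), (if m ≤ j then ((n : ℝ) * ε) ^ j else 0) := by
        refine sum_le_sum fun j _ => ?_
        split_ifs with hj
        · rw [mul_pow]
          refine mul_le_mul_of_nonneg_right ?_ (pow_nonneg hε0 _)
          exact_mod_cast Nat.choose_le_pow n j
        · rw [mul_zero]
    _ ≤ 2 * ((n : ℝ) * ε) ^ m := sum_range_ite_pow_le hx0 hnε m (n + 1)

/-! ### Lemma 4.3: the truncated functional on `c · (1 + h)`, `c` a `d`-conjunction, `h` decaying -/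

/-- **Lemma 4.3 (robust non-negativity on one term)**: for a degree-`4d` Sherali–Adams pseudoexpectation `Ẽ`,
a `d`-conjunction `c = C_{I,α}` (`|I| ≤ d`) and an `ε`-decaying `h` with `nε ≤ 1/2`,
`Ẽ_trunc[c (1 + h)] ≥ −2 (nε)^{3d+1} · #{S : |S| ≤ 4d}`. Printed proof followed literally: write
`h = Σ_S ĥ(S) χ_S`, split at `|S| ≤ 3d`; the low part contributes `≥ −Ẽ[c] Σ_{S≠∅} ε^{|S|} ≥ −Ẽ[c]`
(Lemma 4.2, `2nε ≤ 1`), cancelled by `Ẽ[c] ≥ 0`; the high part contributes `≥ −#{S : |S| ≤ 4d}·Σ_{|S|>3d} ε^{|S|}`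
(`E|c χ_S| = E c = 1`). (Printed conclusion "`≥ −n^{−8d}`" for `ε = 1/n⁴`; see the module docstring, note (3).)
[cite: KothariMekaRaghavendra2017, Lemma 4.3 (§4.2)] -/
theorem SAPseudoexpectation.truncate_E_conjunction_mul_ge {d : ℕ} (pE : SAPseudoexpectation n (4 * d))
    {I : Finset (Fin n)} (hI : I.card ≤ d) (α : Fin n → Bool) {ε : ℝ} (hε0 : 0 ≤ ε)
    (hnε : (n : ℝ) * ε ≤ 1 / 2) {h : (Fin n → Bool) → ℝ} (hh : IsDecaying ε h) :
    -(2 * ((n : ℝ) * ε) ^ (3 * d + 1) * (univ.filter (fun S : Finset (Fin n) => S.card ≤ 4 * d)).card) ≤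
      pE.truncate.E (fun x => conjunction I α x * (1 + h x)) := by
  classical
  set c : (Fin n → Bool) → ℝ := conjunction I α with hc
  set N : ℝ := ((univ.filter (fun S : Finset (Fin n) => S.card ≤ 4 * d)).card : ℝ) with hN
  -- the expansion `c (1 + h) = c + Σ_S ĥ(S) · (c χ_S)`
  have hexp : (fun x => c x * (1 + h x)) =
      c + ∑ S : Finset (Fin n), cubeFourierCoeff h S • (fun x => c x * walsh S x) := by
    funext x
    simp only [Pi.add_apply, Finset.sum_apply, Pi.smul_apply, smul_eq_mul]
    rw [← sum_cubeFourierCoeff_mul_walsh h x, mul_add, mul_one, Finset.mul_sum]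
    congr 1
    exact sum_congr rfl fun S _ => by ring
  have hE : pE.truncate.E (fun x => c x * (1 + h x)) =
      pE.truncate.E c + ∑ S, cubeFourierCoeff h S * pE.truncate.E (fun x => c x * walsh S x) := by
    rw [hexp, map_add, map_sum]
    congr 1
    exact sum_congr rfl fun S _ => by rw [map_smul, smul_eq_mul]
  -- the conjunction: non-negative `d`-junta on `I`, degree `≤ d ≤ 4d`
  have hc0 : ∀ x, 0 ≤ c x := conjunction_nonneg I α
  have hcj : IsJunta d c := (isJunta_conjunction I α).mono hI
  have hcj4 : IsJunta (4 * d) c := hcj.mono (by omega)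
  have hEc : pE.truncate.E c = pE.E c := pE.truncate_E_of_hasDegreeLE hcj4.hasDegreeLE
  have hEc0 : 0 ≤ pE.E c := pE.nonneg c hcj4 hc0
  -- LOW levels `|S| ≤ 3d`: the term is `≥ −ε^{|S|} Ẽ[c]`, and `0` for `S = ∅` (`ĥ(∅) = E h = 0`)
  have hlow : ∀ S : Finset (Fin n), S.card ≤ 3 * d →
      -((if S.card = 0 then 0 else ε ^ S.card) * pE.E c) ≤
        cubeFourierCoeff h S * pE.truncate.E (fun x => c x * walsh S x) := by
    intro S hS
    by_cases hS0 : S.card = 0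
    · have hSe : S = ∅ := Finset.card_eq_zero.1 hS0
      subst hSe
      rw [if_pos Finset.card_empty, zero_mul, neg_zero]
      have h0 : cubeFourierCoeff h ∅ = 0 := by
        rw [cubeFourierCoeff_empty]
        exact hh.1
      rw [h0, zero_mul]
    · rw [if_neg hS0]
      have hdeg : HasDegreeLE (4 * d) (fun x => c x * walsh S x) :=
        (hcj.hasDegreeLE.mul (hasDegreeLE_walsh S)).mono (by omega)
      rw [pE.truncate_E_of_hasDegreeLE hdeg]
      have hb : |pE.E (fun x => c x * walsh S x)| ≤ pE.E c :=
        pE.abs_E_junta_mul_walsh_le hc0 (T := I) (fun _ _ hxy => conjunction_congr I α hxy) S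
          ((Finset.card_union_le I S).trans (by omega))
      have h1 : |cubeFourierCoeff h S * pE.E (fun x => c x * walsh S x)| ≤ ε ^ S.card * pE.E c := by
        rw [abs_mul]
        exact mul_le_mul (hh.2 S) hb (abs_nonneg _) (pow_nonneg hε0 _)
      linarith [neg_abs_le (cubeFourierCoeff h S * pE.E (fun x => c x * walsh S x))]
  -- HIGH levels `|S| > 3d`: the term is `≥ −ε^{|S|} · N` (`|Ẽ_trunc g| ≤ N E|g|`, `E|c χ_S| = 1`)
  have hhigh : ∀ S : Finset (Fin n), ¬ S.card ≤ 3 * d →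
      -(ε ^ S.card * N) ≤ cubeFourierCoeff h S * pE.truncate.E (fun x => c x * walsh S x) := by
    intro S _
    have hb : |pE.truncate.E (fun x => c x * walsh S x)| ≤ N := by
      have h1 := pE.abs_truncate_E_le_cubeExpect_abs_mul_card (fun x => c x * walsh S x)
      rw [hc, cubeExpect_abs_conjunction_mul_walsh, one_mul] at h1
      rw [hN, hc]
      exact h1
    have h1 : |cubeFourierCoeff h S * pE.truncate.E (fun x => c x * walsh S x)| ≤ ε ^ S.card * N := by
      rw [abs_mul]
      exact mul_le_mul (hh.2 S) hb (abs_nonneg _) (pow_nonneg hε0 _)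
    linarith [neg_abs_le (cubeFourierCoeff h S * pE.truncate.E (fun x => c x * walsh S x))]
  -- the two tail sums
  have hA : ∑ S ∈ univ.filter (fun S : Finset (Fin n) => S.card ≤ 3 * d),
      (if S.card = 0 then 0 else ε ^ S.card) ≤ 2 * ((n : ℝ) * ε) := by
    calc ∑ S ∈ univ.filter (fun S : Finset (Fin n) => S.card ≤ 3 * d),
          (if S.card = 0 then 0 else ε ^ S.card)
        ≤ ∑ S : Finset (Fin n), (if S.card = 0 then 0 else ε ^ S.card) :=
          sum_le_sum_of_subset_of_nonneg (filter_subset _ _) fun S _ _ => by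
            split_ifs <;> positivity
      _ = ∑ S ∈ univ.filter (fun S : Finset (Fin n) => 1 ≤ S.card), ε ^ S.card := by
          rw [Finset.sum_filter]
          refine sum_congr rfl fun S _ => ?_
          by_cases h0 : S.card = 0
          · simp [h0]
          · rw [if_neg h0, if_pos (Nat.one_le_iff_ne_zero.2 h0)]
      _ ≤ 2 * ((n : ℝ) * ε) ^ 1 := sum_pow_card_filter_le n 1 hε0 hnε
      _ = 2 * ((n : ℝ) * ε) := by rw [pow_one]
  have hB : ∑ S ∈ univ.filter (fun S : Finset (Fin n) => ¬ S.card ≤ 3 * d), ε ^ S.card ≤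
      2 * ((n : ℝ) * ε) ^ (3 * d + 1) := by
    have hset : univ.filter (fun S : Finset (Fin n) => ¬ S.card ≤ 3 * d) =
        univ.filter (fun S : Finset (Fin n) => 3 * d + 1 ≤ S.card) := by
      ext S
      simp only [mem_filter, mem_univ, true_and, not_le]
      omega
    rw [hset]
    exact sum_pow_card_filter_le n (3 * d + 1) hε0 hnε
  -- summing the termwise bounds
  have hlowsum : -(2 * ((n : ℝ) * ε) * pE.E c) ≤
      ∑ S ∈ univ.filter (fun S : Finset (Fin n) => S.card ≤ 3 * d),
        cubeFourierCoeff h S * pE.truncate.E (fun x => c x * walsh S x) := by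
    calc -(2 * ((n : ℝ) * ε) * pE.E c)
        ≤ -((∑ S ∈ univ.filter (fun S : Finset (Fin n) => S.card ≤ 3 * d),
            (if S.card = 0 then 0 else ε ^ S.card)) * pE.E c) := by
          have := mul_le_mul_of_nonneg_right hA hEc0
          linarith
      _ = ∑ S ∈ univ.filter (fun S : Finset (Fin n) => S.card ≤ 3 * d),
            -((if S.card = 0 then 0 else ε ^ S.card) * pE.E c) := by
          rw [Finset.sum_mul, Finset.sum_neg_distrib]
      _ ≤ _ := sum_le_sum fun S hS => hlow S (mem_filter.1 hS).2
  have hhighsum : -(2 * ((n : ℝ) * ε) ^ (3 * d + 1) * N) ≤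
      ∑ S ∈ univ.filter (fun S : Finset (Fin n) => ¬ S.card ≤ 3 * d),
        cubeFourierCoeff h S * pE.truncate.E (fun x => c x * walsh S x) := by
    have hN0 : 0 ≤ N := by rw [hN]; positivity
    calc -(2 * ((n : ℝ) * ε) ^ (3 * d + 1) * N)
        ≤ -((∑ S ∈ univ.filter (fun S : Finset (Fin n) => ¬ S.card ≤ 3 * d), ε ^ S.card) * N) := by
          have := mul_le_mul_of_nonneg_right hB hN0
          linarith
      _ = ∑ S ∈ univ.filter (fun S : Finset (Fin n) => ¬ S.card ≤ 3 * d), -(ε ^ S.card * N) := by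
          rw [Finset.sum_mul, Finset.sum_neg_distrib]
      _ ≤ _ := sum_le_sum fun S hS => hhigh S (mem_filter.1 hS).2
  have hsplit := Finset.sum_filter_add_sum_filter_not (univ : Finset (Finset (Fin n)))
    (fun S : Finset (Fin n) => S.card ≤ 3 * d)
    (fun S => cubeFourierCoeff h S * pE.truncate.E (fun x => c x * walsh S x))
  rw [hE, ← hsplit, hEc]
  have h2nε : 2 * ((n : ℝ) * ε) ≤ 1 := by linarith
  have hcancel : -pE.E c ≤ -(2 * ((n : ℝ) * ε) * pE.E c) := by nlinarith
  linarith

/-! ### The arithmetic of the final contradiction -/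

/-- The numerical inequality behind "Proof of Lemma 2.4" (for `n ≥ 4d + 1`, `d ≥ 1`): with `ε < n^{−4}`,
`0 ≤ δ < n^{−8d}` and `N ≤ 1 + n^{4d}`, `N·(2(nε)^{3d+1} + δ) < 1/n` (indeed `≤ 3 n^{−4d}`).
[cite: KothariMekaRaghavendra2017, §4.2 (proof of Lemma 2.4: "≥ −1/n^{8d} − n^{4d} n^{−8d} > −η")] -/
theorem KMR_lemma24_arith {n d : ℕ} (hd : 1 ≤ d) (hn : 4 * d + 1 ≤ n) {ε δ N : ℝ}
    (hε0 : 0 ≤ ε) (hε : ε < 1 / (n : ℝ) ^ 4) (hδ0 : 0 ≤ δ) (hδ : δ < 1 / (n : ℝ) ^ (8 * d))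
    (hN0 : 0 ≤ N) (hN : N ≤ 1 + (n : ℝ) ^ (4 * d)) :
    N * (2 * ((n : ℝ) * ε) ^ (3 * d + 1) + δ) < 1 / n := by
  have hn5 : (5 : ℝ) ≤ n := by exact_mod_cast (by omega : 5 ≤ n)
  have hn0 : (0 : ℝ) < n := by linarith
  have hn1 : (1 : ℝ) ≤ n := by linarith
  -- `nε ≤ n^{-3}`
  have h1 : (n : ℝ) * ε ≤ 1 / (n : ℝ) ^ 3 := by
    calc (n : ℝ) * ε ≤ (n : ℝ) * (1 / (n : ℝ) ^ 4) := mul_le_mul_of_nonneg_left hε.le hn0.le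
      _ = 1 / (n : ℝ) ^ 3 := by field_simp
  have hmε0 : 0 ≤ (n : ℝ) * ε := by positivity
  -- `(nε)^{3d+1} ≤ n^{-(9d+3)} ≤ n^{-(8d+2)}`
  have h2 : ((n : ℝ) * ε) ^ (3 * d + 1) ≤ 1 / (n : ℝ) ^ (8 * d + 2) := by
    calc ((n : ℝ) * ε) ^ (3 * d + 1) ≤ (1 / (n : ℝ) ^ 3) ^ (3 * d + 1) := pow_le_pow_left₀ hmε0 h1 _
      _ = 1 / (n : ℝ) ^ (9 * d + 3) := by rw [one_div_pow, ← pow_mul]; ring_nf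
      _ ≤ 1 / (n : ℝ) ^ (8 * d + 2) := by
          apply one_div_le_one_div_of_le (by positivity)
          exact pow_le_pow_right₀ hn1 (by omega)
  -- `N ≤ 2 n^{4d}`
  have h3 : N ≤ 2 * (n : ℝ) ^ (4 * d) := by
    have : (1 : ℝ) ≤ (n : ℝ) ^ (4 * d) := one_le_pow₀ hn1
    linarith
  have h4 : 2 * ((n : ℝ) * ε) ^ (3 * d + 1) + δ < 2 / (n : ℝ) ^ (8 * d + 2) + 1 / (n : ℝ) ^ (8 * d) := by
    have : 2 / (n : ℝ) ^ (8 * d + 2) = 2 * (1 / (n : ℝ) ^ (8 * d + 2)) := by ring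
    rw [this]
    linarith
  have hsum0 : 0 ≤ 2 * ((n : ℝ) * ε) ^ (3 * d + 1) + δ := by positivity
  have h5 : N * (2 * ((n : ℝ) * ε) ^ (3 * d + 1) + δ) ≤
      2 * (n : ℝ) ^ (4 * d) * (2 * ((n : ℝ) * ε) ^ (3 * d + 1) + δ) :=
    mul_le_mul_of_nonneg_right h3 hsum0
  have h6 : 2 * (n : ℝ) ^ (4 * d) * (2 * ((n : ℝ) * ε) ^ (3 * d + 1) + δ) <
      2 * (n : ℝ) ^ (4 * d) * (2 / (n : ℝ) ^ (8 * d + 2) + 1 / (n : ℝ) ^ (8 * d)) :=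
    mul_lt_mul_of_pos_left h4 (by positivity)
  have h7 : 2 * (n : ℝ) ^ (4 * d) * (2 / (n : ℝ) ^ (8 * d + 2) + 1 / (n : ℝ) ^ (8 * d)) =
      4 / (n : ℝ) ^ (4 * d + 2) + 2 / (n : ℝ) ^ (4 * d) := by
    have hm0 : (n : ℝ) ≠ 0 := hn0.ne'
    have e1 : (n : ℝ) ^ (8 * d + 2) = (n : ℝ) ^ (4 * d) * (n : ℝ) ^ (4 * d + 2) := by
      rw [← pow_add]; ring_nf
    have e2 : (n : ℝ) ^ (8 * d) = (n : ℝ) ^ (4 * d) * (n : ℝ) ^ (4 * d) := by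
      rw [← pow_add]; ring_nf
    rw [e1, e2]
    field_simp
    ring
  have h8 : 4 / (n : ℝ) ^ (4 * d + 2) ≤ 1 / (n : ℝ) ^ (4 * d) := by
    rw [div_le_div_iff₀ (by positivity) (by positivity)]
    have e3 : (n : ℝ) ^ (4 * d + 2) = (n : ℝ) ^ (4 * d) * (n : ℝ) ^ 2 := by ring
    rw [e3]
    have : (25 : ℝ) ≤ (n : ℝ) ^ 2 := by nlinarith
    nlinarith [pow_pos hn0 (4 * d)]
  have h9 : 3 / (n : ℝ) ^ (4 * d) < 1 / n := by
    rw [div_lt_div_iff₀ (by positivity) hn0]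
    have e4 : (n : ℝ) ^ 4 ≤ (n : ℝ) ^ (4 * d) := pow_le_pow_right₀ hn1 (by omega)
    have e5 : (125 : ℝ) ≤ (n : ℝ) ^ 3 := by
      have := pow_le_pow_left₀ (by norm_num : (0 : ℝ) ≤ 5) hn5 3
      norm_num at this
      exact this
    have e6 : (n : ℝ) ^ 4 = (n : ℝ) * (n : ℝ) ^ 3 := by ring
    nlinarith
  calc N * (2 * ((n : ℝ) * ε) ^ (3 * d + 1) + δ)
      ≤ 2 * (n : ℝ) ^ (4 * d) * (2 * ((n : ℝ) * ε) ^ (3 * d + 1) + δ) := h5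
    _ < 2 * (n : ℝ) ^ (4 * d) * (2 / (n : ℝ) ^ (8 * d + 2) + 1 / (n : ℝ) ^ (8 * d)) := h6
    _ = 4 / (n : ℝ) ^ (4 * d + 2) + 2 / (n : ℝ) ^ (4 * d) := h7
    _ ≤ 3 / (n : ℝ) ^ (4 * d) := by
        have : 2 / (n : ℝ) ^ (4 * d) + 1 / (n : ℝ) ^ (4 * d) = 3 / (n : ℝ) ^ (4 * d) := by ring
        linarith
    _ < 1 / n := h9

/-! ### Lemma 2.4 -/

/-- **KMR Lemma 2.4, in the form the printed proof delivers (`4d`).** If `f ≥ 0` on `{0,1}ⁿ` has degree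
`≤ d` and is an `(ε,δ)`-approximate conical `d`-junta with `0 ≤ ε < 1/n⁴` and `δ < 1/n^{8d}`, then
`f + 1/n` is a conical `4d`-junta, i.e. `deg_+(f + 1/n) ≤ 4d`. Proof as printed ("Proof of Lemma 2.4",
§4.2): otherwise Lemma 4.1 gives a degree-`4d` Sherali–Adams functional `Ẽ` with `Ẽ[f] < −1/n`, while
`Ẽ[f] = Σ λ_i Ẽ[c_i(1+h_i)] + Ẽ[γ] ≥ −#{S : |S| ≤ 4d}·(2(nε)^{3d+1} + δ) > −1/n` by Lemma 4.3 and
`|Ẽ γ| ≤ #{S : |S| ≤ 4d}·E γ`; the range `n ≤ 4d` is trivial (`deg_+ ≤ n`) and `d = 0` forces `f` constant.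
[cite: KothariMekaRaghavendra2017, Lemma 2.4 with its proof (§2.1, §4.2)] -/
theorem nonnegDegree_add_inv_le_of_isApproxConicalJunta {d : ℕ} {ε δ : ℝ} {f : (Fin n → Bool) → ℝ}
    (hf0 : ∀ x, 0 ≤ f x) (happ : IsApproxConicalJunta ε δ d f) (hε0 : 0 ≤ ε)
    (hε : ε < 1 / (n : ℝ) ^ 4) (hdeg : HasDegreeLE d f) (hδ : δ < 1 / (n : ℝ) ^ (8 * d)) :
    nonnegDegree (fun x => f x + 1 / n) ≤ 4 * d := by
  classical
  have hfη0 : ∀ x, 0 ≤ f x + 1 / n := fun x => add_nonneg (hf0 x) (by positivity)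
  -- trivial range `n ≤ 4d`
  by_cases hn : n ≤ 4 * d
  · exact (nonnegDegree_le _).trans hn
  have hn' : 4 * d + 1 ≤ n := by omega
  rcases Nat.eq_zero_or_pos d with hd0 | hdpos
  · -- `d = 0`: `f` is constant, `f + 1/n` a non-negative constant
    subst hd0
    have hconst : (fun x => f x + 1 / n) = fun _ => cubeFourierCoeff f ∅ + 1 / n :=
      funext fun x => by rw [eq_const_of_hasDegreeLE_zero hdeg x]
    refine (isConicalJunta_iff_nonnegDegree_le hfη0).1 ?_
    rw [hconst]
    refine isConicalJunta_const_of_nonneg _ ?_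
    have hx0 : (fun _ : Fin n => false) = (fun _ : Fin n => false) := rfl
    have := hfη0 (fun _ => false)
    rwa [eq_const_of_hasDegreeLE_zero hdeg] at this
  · -- main case `d ≥ 1`, `n ≥ 4d + 1`
    by_contra H
    have hnot : ¬ IsConicalJunta (4 * d) (fun x => f x + 1 / n) := fun h' =>
      H ((isConicalJunta_iff_nonnegDegree_le hfη0).1 h')
    obtain ⟨pE, hpE⟩ := exists_lt_of_not_isConicalJunta hnot
    obtain ⟨M, lam, C, h, err, hlam0, hlam1, hC, hh, herr0, herrδ, hrep⟩ := happ
    have hn0 : (0 : ℝ) < n := by exact_mod_cast (by omega : 0 < n)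
    have hnε : (n : ℝ) * ε ≤ 1 / 2 := by
      have hn5 : (5 : ℝ) ≤ n := by exact_mod_cast (by omega : 5 ≤ n)
      have h1 : (n : ℝ) * ε ≤ (n : ℝ) * (1 / (n : ℝ) ^ 4) := mul_le_mul_of_nonneg_left hε.le hn0.le
      have h2 : (n : ℝ) * (1 / (n : ℝ) ^ 4) = 1 / (n : ℝ) ^ 3 := by field_simp
      have h3 : 1 / (n : ℝ) ^ 3 ≤ 1 / 2 := by
        apply one_div_le_one_div_of_le (by norm_num)
        have h53 := pow_le_pow_left₀ (by norm_num : (0 : ℝ) ≤ 5) hn5 3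
        norm_num at h53
        linarith
      linarith
    set N : ℝ := ((univ.filter (fun S : Finset (Fin n) => S.card ≤ 4 * d)).card : ℝ) with hN
    -- `Ẽ_trunc f = Ẽ f < -1/n` (`deg f ≤ d ≤ 4d`)
    have hEf : pE.truncate.E f = pE.E f := pE.truncate_E_of_hasDegreeLE (hdeg.mono (by omega))
    -- `Ẽ_trunc f` along the representation
    have hfun : f = ∑ i, lam i • (fun x => C i x * (1 + h i x)) + err := by
      funext x
      rw [hrep x]
      simp only [Pi.add_apply, Finset.sum_apply, Pi.smul_apply, smul_eq_mul]
    have hE : pE.truncate.E f =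
        ∑ i, lam i * pE.truncate.E (fun x => C i x * (1 + h i x)) + pE.truncate.E err := by
      conv_lhs => rw [hfun]
      rw [map_add, map_sum]
      congr 1
      exact sum_congr rfl fun i _ => by rw [map_smul, smul_eq_mul]
    -- each junta term (Lemma 4.3)
    have hterm : ∀ i, -(2 * ((n : ℝ) * ε) ^ (3 * d + 1) * N) ≤
        pE.truncate.E (fun x => C i x * (1 + h i x)) := by
      intro i
      obtain ⟨I, α, hI, hCi⟩ := hC i
      rw [hCi]
      exact pE.truncate_E_conjunction_mul_ge hI α hε0 hnε (hh i)
    -- the additive error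
    have herrE : -(δ * N) ≤ pE.truncate.E err := by
      have h1 := pE.abs_truncate_E_le_cubeExpect_abs_mul_card err
      have habs : (fun x => |err x|) = err := funext fun x => abs_of_nonneg (herr0 x)
      rw [habs] at h1
      have hN0 : 0 ≤ N := by rw [hN]; positivity
      have h2 : cubeExpect err * N ≤ δ * N := mul_le_mul_of_nonneg_right herrδ hN0
      rw [hN] at h2
      linarith [neg_abs_le (pE.truncate.E err)]
    -- summing
    have hX0 : 0 ≤ 2 * ((n : ℝ) * ε) ^ (3 * d + 1) * N := by rw [hN]; positivity
    have hsum : -(2 * ((n : ℝ) * ε) ^ (3 * d + 1) * N) ≤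
        ∑ i, lam i * pE.truncate.E (fun x => C i x * (1 + h i x)) := by
      have hl0 : 0 ≤ ∑ i, lam i := sum_nonneg fun i _ => hlam0 i
      calc -(2 * ((n : ℝ) * ε) ^ (3 * d + 1) * N)
          ≤ (∑ i, lam i) * (-(2 * ((n : ℝ) * ε) ^ (3 * d + 1) * N)) := by nlinarith
        _ = ∑ i, lam i * (-(2 * ((n : ℝ) * ε) ^ (3 * d + 1) * N)) := by rw [Finset.sum_mul]
        _ ≤ _ := sum_le_sum fun i _ => mul_le_mul_of_nonneg_left (hterm i) (hlam0 i)
    -- the arithmetic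
    have hδ0 : 0 ≤ δ := (cubeExpect_nonneg herr0).trans herrδ
    have hNle : N ≤ 1 + (n : ℝ) ^ (4 * d) := by
      rw [hN, card_filter_card_le]
      exact_mod_cast sum_range_choose_le_one_add_pow n (4 * d)
    have hnum := KMR_lemma24_arith hdpos hn' hε0 hε hδ0 hδ (by rw [hN]; positivity) hNle
    have hge : -(N * (2 * ((n : ℝ) * ε) ^ (3 * d + 1) + δ)) ≤ pE.truncate.E f := by
      rw [hE]
      nlinarith [hsum, herrE]
    rw [hEf] at hge
    linarith

/-- **Kothari–Meka–Raghavendra 2017, Lemma 2.4 — PROVED** (verbatim conclusion `8d`). "Suppose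
`f : {−1,1}ⁿ → ℝ_{≥0}` [with `E[f] ≤ 1`] is an `(ε,δ)`-approximate conical `d`-junta for `ε < 1/n⁴` and some
`d ≥ deg(f)` and `δ < 1/n^{8d}` then `deg_+(f + 1/n) ≤ 8d`." Here `deg(f) ≤ d` is `cubeDegree f ≤ d`,
`deg_+` is `nonnegDegree`, `0 ≤ ε` is assumed and the unused printed hypothesis `E[f] ≤ 1` is dropped (see the
module docstring, notes (1)–(4); the sharper `4d` is `nonnegDegree_add_inv_le_of_isApproxConicalJunta`).
[cite: KothariMekaRaghavendra2017, Lemma 2.4 (§2.1; proof §4.2)] -/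
theorem KothariMekaRaghavendra2017_lemma24 {d : ℕ} {ε δ : ℝ} {f : (Fin n → Bool) → ℝ}
    (hf0 : ∀ x, 0 ≤ f x) (happ : IsApproxConicalJunta ε δ d f) (hε0 : 0 ≤ ε)
    (hε : ε < 1 / (n : ℝ) ^ 4) (hdeg : cubeDegree f ≤ d) (hδ : δ < 1 / (n : ℝ) ^ (8 * d)) :
    nonnegDegree (fun x => f x + 1 / n) ≤ 8 * d :=
  (nonnegDegree_add_inv_le_of_isApproxConicalJunta hf0 happ hε0 hε ((cubeDegree_le_iff f d).1 hdeg)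
    hδ).trans (by omega)

/-- Lemma 2.4 as an `IsConicalJunta` statement: under the same hypotheses `f + 1/n` is a conical
`4d`-junta (hence an `8d`-junta). [cite: KothariMekaRaghavendra2017, Lemma 2.4 (§2.1; proof §4.2)] -/
theorem isConicalJunta_add_inv_of_isApproxConicalJunta {d : ℕ} {ε δ : ℝ} {f : (Fin n → Bool) → ℝ}
    (hf0 : ∀ x, 0 ≤ f x) (happ : IsApproxConicalJunta ε δ d f) (hε0 : 0 ≤ ε)
    (hε : ε < 1 / (n : ℝ) ^ 4) (hdeg : HasDegreeLE d f) (hδ : δ < 1 / (n : ℝ) ^ (8 * d)) :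
    IsConicalJunta (4 * d) (fun x => f x + 1 / n) :=
  (isConicalJunta_iff_nonnegDegree_le fun x => add_nonneg (hf0 x) (by positivity)).2
    (nonnegDegree_add_inv_le_of_isApproxConicalJunta hf0 happ hε0 hε hdeg hδ)

/-! ### Closure properties of approximate conical juntas (bookkeeping for §4.1)

The representation of Def. 2.2 is stable under: weakening the parameters, scaling by `s ∈ [0,1]`, adding a
non-negative function of small mean to the error, and taking sub-convex combinations (re-indexing a finite
family of representations along `Fintype.equivFin`). These are the manipulations used silently in §4.1
("Therefore, `J` is an `(ε,δ')`-approximate conical `d`-junta with `δ' = (Σ_{i∈Q} λ_i)·ε^d`", "the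
contribution from all the small rectangles can be included into the additive error term `γ(z)`"). -/

/-- `E[g + e] = E[g] + E[e]`. [cite: KothariMekaRaghavendra2017, §2.1 ("E[f] denotes the expectation of f on the uniform distribution")] -/
theorem cubeExpect_add (g e : (Fin n → Bool) → ℝ) :
    cubeExpect (fun x => g x + e x) = cubeExpect g + cubeExpect e := by
  simp only [cubeExpect, Finset.sum_add_distrib, add_div]

/-- `E` is monotone. [cite: KothariMekaRaghavendra2017, §2.1] -/
theorem cubeExpect_mono {g e : (Fin n → Bool) → ℝ} (h : ∀ x, g x ≤ e x) : cubeExpect g ≤ cubeExpect e := by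
  unfold cubeExpect
  exact div_le_div_of_nonneg_right (Finset.sum_le_sum fun x _ => h x) (by positivity)

/-- `E[Σ_l w_l g_l] = Σ_l w_l E[g_l]`. [cite: KothariMekaRaghavendra2017, §4.1 ("E[δ_1] = Σ_{i∉Q} λ_i")] -/
theorem cubeExpect_sum_mul {ι : Type*} (s : Finset ι) (w : ι → ℝ) (g : ι → (Fin n → Bool) → ℝ) :
    cubeExpect (fun x => ∑ l ∈ s, w l * g l x) = ∑ l ∈ s, w l * cubeExpect (g l) := by
  simp only [cubeExpect, mul_div_assoc', ← Finset.sum_div]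
  rw [Finset.sum_comm]
  simp only [Finset.mul_sum]

/-- Weakening the parameters of an approximate conical junta. [cite: KothariMekaRaghavendra2017, Def. 2.2 (§2.1)] -/
theorem IsApproxConicalJunta.mono {ε ε' δ δ' : ℝ} {d : ℕ} {f : (Fin n → Bool) → ℝ}
    (hf : IsApproxConicalJunta ε δ d f) (hε0 : 0 ≤ ε) (hε : ε ≤ ε') (hδ : δ ≤ δ') :
    IsApproxConicalJunta ε' δ' d f := by
  obtain ⟨N, lam, C, h, γ, hlam0, hlam1, hC, hh, hγ0, hγ, hrep⟩ := hf
  exact ⟨N, lam, C, h, γ, hlam0, hlam1, hC,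
    fun i => ⟨(hh i).1, fun S => ((hh i).2 S).trans (pow_le_pow_left₀ hε0 hε _)⟩, hγ0, hγ.trans hδ, hrep⟩

/-- Weakening the degree of an approximate conical junta. [cite: KothariMekaRaghavendra2017, Def. 2.2 (§2.1)] -/
theorem IsApproxConicalJunta.degree_mono {ε δ : ℝ} {d d' : ℕ} {f : (Fin n → Bool) → ℝ}
    (hf : IsApproxConicalJunta ε δ d f) (hd : d ≤ d') : IsApproxConicalJunta ε δ d' f := by
  obtain ⟨N, lam, C, h, γ, hlam0, hlam1, hC, hh, hγ0, hγ, hrep⟩ := hf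
  refine ⟨N, lam, C, h, γ, hlam0, hlam1, fun i => ?_, hh, hγ0, hγ, hrep⟩
  obtain ⟨I, α, hI, hCI⟩ := hC i
  exact ⟨I, α, hI.trans hd, hCI⟩

/-- Scaling an approximate conical junta by `s ∈ [0,1]`. [cite: KothariMekaRaghavendra2017, Def. 2.2 (§2.1)] -/
theorem IsApproxConicalJunta.smul {ε δ : ℝ} {d : ℕ} {f : (Fin n → Bool) → ℝ}
    (hf : IsApproxConicalJunta ε δ d f) {s : ℝ} (hs0 : 0 ≤ s) (hs1 : s ≤ 1) :
    IsApproxConicalJunta ε δ d (fun x => s * f x) := by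
  obtain ⟨N, lam, C, h, γ, hlam0, hlam1, hC, hh, hγ0, hγ, hrep⟩ := hf
  have hl0 : 0 ≤ ∑ i, lam i := sum_nonneg fun i _ => hlam0 i
  have hγE0 : 0 ≤ cubeExpect γ := cubeExpect_nonneg hγ0
  refine ⟨N, fun i => s * lam i, C, h, fun x => s * γ x, fun i => mul_nonneg hs0 (hlam0 i), ?_, hC, hh,
    fun x => mul_nonneg hs0 (hγ0 x), ?_, fun x => ?_⟩
  · rw [← mul_sum]; nlinarith
  · rw [cubeExpect_const_mul]; nlinarith
  · show s * f x = ∑ i, s * lam i * (C i x * (1 + h i x)) + s * γ x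
    rw [hrep x, mul_add, mul_sum]
    exact congrArg₂ (· + ·) (sum_congr rfl fun i _ => by ring) rfl

/-- Adding a non-negative function of mean `≤ δ'` to an `(ε,δ)`-approximate conical junta gives an
`(ε, δ + δ')`-approximate conical junta. [cite: KothariMekaRaghavendra2017, §4.1 ("the contribution from all the small rectangles can be included into the additive error term")] -/
theorem IsApproxConicalJunta.add_error {ε δ δ' : ℝ} {d : ℕ} {f e : (Fin n → Bool) → ℝ}
    (hf : IsApproxConicalJunta ε δ d f) (he0 : ∀ x, 0 ≤ e x) (he : cubeExpect e ≤ δ') :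
    IsApproxConicalJunta ε (δ + δ') d (fun x => f x + e x) := by
  obtain ⟨N, lam, C, h, γ, hlam0, hlam1, hC, hh, hγ0, hγ, hrep⟩ := hf
  refine ⟨N, lam, C, h, fun x => γ x + e x, hlam0, hlam1, hC, hh, fun x => add_nonneg (hγ0 x) (he0 x),
    ?_, fun x => ?_⟩
  · rw [cubeExpect_add]; exact add_le_add hγ he
  · show f x + e x = ∑ i, lam i * (C i x * (1 + h i x)) + (γ x + e x)
    rw [hrep x]; ring

/-- A representation indexed by an arbitrary finite type is an approximate conical junta (re-indexing along
`Fintype.equivFin`). [cite: KothariMekaRaghavendra2017, Def. 2.2 (§2.1)] -/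
theorem isApproxConicalJunta_of_fintype {ι : Type*} [Fintype ι] {ε δ : ℝ} {d : ℕ}
    {f : (Fin n → Bool) → ℝ} (lam : ι → ℝ) (C h : ι → (Fin n → Bool) → ℝ) (γ : (Fin n → Bool) → ℝ)
    (hlam0 : ∀ i, 0 ≤ lam i) (hlam1 : ∑ i, lam i ≤ 1) (hC : ∀ i, IsConjunction d (C i))
    (hh : ∀ i, IsDecaying ε (h i)) (hγ0 : ∀ x, 0 ≤ γ x) (hγ : cubeExpect γ ≤ δ)
    (hrep : ∀ x, f x = ∑ i, lam i * (C i x * (1 + h i x)) + γ x) : IsApproxConicalJunta ε δ d f := by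
  classical
  set e := Fintype.equivFin ι
  refine ⟨Fintype.card ι, fun j => lam (e.symm j), fun j => C (e.symm j), fun j => h (e.symm j), γ,
    fun j => hlam0 _, ?_, fun j => hC _, fun j => hh _, hγ0, hγ, fun x => ?_⟩
  · rwa [e.symm.sum_comp (fun i => lam i)]
  · rw [hrep x, e.symm.sum_comp (fun i => lam i * (C i x * (1 + h i x)))]

/-- **Sub-convex combinations of approximate conical juntas** (finite families): if each `g_l` is an
`(ε, δ_l)`-approximate conical `d`-junta and `w_l ≥ 0`, `Σ w_l ≤ 1`, then `Σ_l w_l g_l` is an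
`(ε, Σ_l w_l δ_l)`-approximate conical `d`-junta. [cite: KothariMekaRaghavendra2017, §4.1 ("Therefore, J is an (ε,δ')-approximate conical d-junta with δ' = (Σ_{i∈Q} λ_i)·ε^d")] -/
theorem isApproxConicalJunta_sum {ι : Type*} [Fintype ι] {ε : ℝ} {d : ℕ} {w δ : ι → ℝ}
    {g : ι → (Fin n → Bool) → ℝ} (hg : ∀ l, IsApproxConicalJunta ε (δ l) d (g l))
    (hw0 : ∀ l, 0 ≤ w l) (hw1 : ∑ l, w l ≤ 1) :
    IsApproxConicalJunta ε (∑ l, w l * δ l) d (fun x => ∑ l, w l * g l x) := by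
  classical
  choose N lam C h γ hlam0 hlam1 hC hh hγ0 hγ hrep using hg
  refine isApproxConicalJunta_of_fintype (ι := Σ l, Fin (N l)) (fun p => w p.1 * lam p.1 p.2)
    (fun p => C p.1 p.2) (fun p => h p.1 p.2) (fun x => ∑ l, w l * γ l x)
    (fun p => mul_nonneg (hw0 _) (hlam0 _ _)) ?_ (fun p => hC _ _) (fun p => hh _ _)
    (fun x => sum_nonneg fun l _ => mul_nonneg (hw0 l) (hγ0 l x)) ?_ fun x => ?_
  · -- `Σ_l w_l Σ_i λ_{l,i} ≤ Σ_l w_l ≤ 1`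
    rw [Fintype.sum_sigma]
    calc ∑ l, ∑ i, w l * lam l i = ∑ l, w l * ∑ i, lam l i := by
          simp only [Finset.mul_sum]
      _ ≤ ∑ l, w l := sum_le_sum fun l _ => by nlinarith [hw0 l, hlam1 l]
      _ ≤ 1 := hw1
  · rw [cubeExpect_sum_mul]
    exact sum_le_sum fun l _ => mul_le_mul_of_nonneg_left (hγ l) (hw0 l)
  · rw [Fintype.sum_sigma, ← Finset.sum_add_distrib]
    refine sum_congr rfl fun l _ => ?_
    rw [hrep l x, mul_add, Finset.mul_sum]
    exact congrArg₂ (· + ·) (sum_congr rfl fun i _ => by ring) rfl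

/-! ### Lemma 2.4 with the shift `1/(2n)`

The printed proof of Lemma 2.4 has slack: the lower bound `Ẽ f ≥ −#{S : |S| ≤ 4d}·(2(nε)^{3d+1} + δ)` is in fact
`> −3/n^{4d} ≥ −1/(2n)` (for `d ≥ 1`, `n ≥ 4d+1`), so `f + η` is an exact conical `4d`-junta for every
`η ≥ 1/(2n)`, not only `η = 1/n`. §4.1 uses this room to absorb the `(1 ± O(n/q))`-factors coming from the
normalisation of the gadget (file `NonnegativeRankConicalJuntas.lean`). -/

/-- The numerical inequality of "Proof of Lemma 2.4" with the factor-2 slack: `N·(2(nε)^{3d+1} + δ) < 1/(2n)`.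
[cite: KothariMekaRaghavendra2017, §4.2 (proof of Lemma 2.4)] -/
theorem KMR_lemma24_arith_half {n d : ℕ} (hd : 1 ≤ d) (hn : 4 * d + 1 ≤ n) {ε δ N : ℝ}
    (hε0 : 0 ≤ ε) (hε : ε < 1 / (n : ℝ) ^ 4) (hδ0 : 0 ≤ δ) (hδ : δ < 1 / (n : ℝ) ^ (8 * d))
    (hN0 : 0 ≤ N) (hN : N ≤ 1 + (n : ℝ) ^ (4 * d)) :
    N * (2 * ((n : ℝ) * ε) ^ (3 * d + 1) + δ) < 1 / (2 * n) := by
  have hn5 : (5 : ℝ) ≤ n := by exact_mod_cast (by omega : 5 ≤ n)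
  have hn0 : (0 : ℝ) < n := by linarith
  have hn1 : (1 : ℝ) ≤ n := by linarith
  have h1 : (n : ℝ) * ε ≤ 1 / (n : ℝ) ^ 3 := by
    calc (n : ℝ) * ε ≤ (n : ℝ) * (1 / (n : ℝ) ^ 4) := mul_le_mul_of_nonneg_left hε.le hn0.le
      _ = 1 / (n : ℝ) ^ 3 := by field_simp
  have hmε0 : 0 ≤ (n : ℝ) * ε := by positivity
  have h2 : ((n : ℝ) * ε) ^ (3 * d + 1) ≤ 1 / (n : ℝ) ^ (8 * d + 2) := by
    calc ((n : ℝ) * ε) ^ (3 * d + 1) ≤ (1 / (n : ℝ) ^ 3) ^ (3 * d + 1) := pow_le_pow_left₀ hmε0 h1 _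
      _ = 1 / (n : ℝ) ^ (9 * d + 3) := by rw [one_div_pow, ← pow_mul]; ring_nf
      _ ≤ 1 / (n : ℝ) ^ (8 * d + 2) := by
          apply one_div_le_one_div_of_le (by positivity)
          exact pow_le_pow_right₀ hn1 (by omega)
  have h3 : N ≤ 2 * (n : ℝ) ^ (4 * d) := by
    have : (1 : ℝ) ≤ (n : ℝ) ^ (4 * d) := one_le_pow₀ hn1
    linarith
  have h4 : 2 * ((n : ℝ) * ε) ^ (3 * d + 1) + δ < 2 / (n : ℝ) ^ (8 * d + 2) + 1 / (n : ℝ) ^ (8 * d) := by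
    have : 2 / (n : ℝ) ^ (8 * d + 2) = 2 * (1 / (n : ℝ) ^ (8 * d + 2)) := by ring
    rw [this]
    linarith
  have hsum0 : 0 ≤ 2 * ((n : ℝ) * ε) ^ (3 * d + 1) + δ := by positivity
  have h5 : N * (2 * ((n : ℝ) * ε) ^ (3 * d + 1) + δ) ≤
      2 * (n : ℝ) ^ (4 * d) * (2 * ((n : ℝ) * ε) ^ (3 * d + 1) + δ) :=
    mul_le_mul_of_nonneg_right h3 hsum0
  have h6 : 2 * (n : ℝ) ^ (4 * d) * (2 * ((n : ℝ) * ε) ^ (3 * d + 1) + δ) <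
      2 * (n : ℝ) ^ (4 * d) * (2 / (n : ℝ) ^ (8 * d + 2) + 1 / (n : ℝ) ^ (8 * d)) :=
    mul_lt_mul_of_pos_left h4 (by positivity)
  have h7 : 2 * (n : ℝ) ^ (4 * d) * (2 / (n : ℝ) ^ (8 * d + 2) + 1 / (n : ℝ) ^ (8 * d)) =
      4 / (n : ℝ) ^ (4 * d + 2) + 2 / (n : ℝ) ^ (4 * d) := by
    have e1 : (n : ℝ) ^ (8 * d + 2) = (n : ℝ) ^ (4 * d) * (n : ℝ) ^ (4 * d + 2) := by
      rw [← pow_add]; ring_nf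
    have e2 : (n : ℝ) ^ (8 * d) = (n : ℝ) ^ (4 * d) * (n : ℝ) ^ (4 * d) := by
      rw [← pow_add]; ring_nf
    rw [e1, e2]
    field_simp
    ring
  have h8 : 4 / (n : ℝ) ^ (4 * d + 2) ≤ 1 / (n : ℝ) ^ (4 * d) := by
    rw [div_le_div_iff₀ (by positivity) (by positivity)]
    have e3 : (n : ℝ) ^ (4 * d + 2) = (n : ℝ) ^ (4 * d) * (n : ℝ) ^ 2 := by ring
    rw [e3]
    have : (25 : ℝ) ≤ (n : ℝ) ^ 2 := by nlinarith
    nlinarith [pow_pos hn0 (4 * d)]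
  have h9 : 3 / (n : ℝ) ^ (4 * d) < 1 / (2 * n) := by
    rw [div_lt_div_iff₀ (by positivity) (by positivity)]
    have e4 : (n : ℝ) ^ 4 ≤ (n : ℝ) ^ (4 * d) := pow_le_pow_right₀ hn1 (by omega)
    have e5 : (125 : ℝ) ≤ (n : ℝ) ^ 3 := by
      have := pow_le_pow_left₀ (by norm_num : (0 : ℝ) ≤ 5) hn5 3
      norm_num at this
      exact this
    have e6 : (n : ℝ) ^ 4 = (n : ℝ) * (n : ℝ) ^ 3 := by ring
    nlinarith
  calc N * (2 * ((n : ℝ) * ε) ^ (3 * d + 1) + δ)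
      ≤ 2 * (n : ℝ) ^ (4 * d) * (2 * ((n : ℝ) * ε) ^ (3 * d + 1) + δ) := h5
    _ < 2 * (n : ℝ) ^ (4 * d) * (2 / (n : ℝ) ^ (8 * d + 2) + 1 / (n : ℝ) ^ (8 * d)) := h6
    _ = 4 / (n : ℝ) ^ (4 * d + 2) + 2 / (n : ℝ) ^ (4 * d) := h7
    _ ≤ 3 / (n : ℝ) ^ (4 * d) := by
        have : 2 / (n : ℝ) ^ (4 * d) + 1 / (n : ℝ) ^ (4 * d) = 3 / (n : ℝ) ^ (4 * d) := by ring
        linarith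
    _ < 1 / (2 * n) := h9

/-- **Lemma 2.4 with the shift `1/(2n)` (and hence any `η ≥ 1/(2n)`).** If `f ≥ 0` has degree `≤ d` and is
an `(ε,δ)`-approximate conical `d`-junta with `0 ≤ ε < 1/n⁴`, `δ < 1/n^{8d}`, then `f + η` is a conical
`4d`-junta for every `η ≥ 1/(2n)`. Same proof as `nonnegDegree_add_inv_le_of_isApproxConicalJunta`, with the
factor-2 slack of the final inequality made explicit. [cite: KothariMekaRaghavendra2017, Lemma 2.4 with its proof (§2.1, §4.2)] -/
theorem isConicalJunta_add_of_isApproxConicalJunta {d : ℕ} {ε δ : ℝ} {f : (Fin n → Bool) → ℝ}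
    (hf0 : ∀ x, 0 ≤ f x) (happ : IsApproxConicalJunta ε δ d f) (hε0 : 0 ≤ ε)
    (hε : ε < 1 / (n : ℝ) ^ 4) (hdeg : HasDegreeLE d f) (hδ : δ < 1 / (n : ℝ) ^ (8 * d))
    {η : ℝ} (hη : 1 / (2 * (n : ℝ)) ≤ η) : IsConicalJunta (4 * d) (fun x => f x + η) := by
  classical
  have hη0 : 0 ≤ η := le_trans (by positivity) hη
  have hfη0 : ∀ x, 0 ≤ f x + η := fun x => add_nonneg (hf0 x) hη0
  -- trivial range `n ≤ 4d`
  by_cases hn : n ≤ 4 * d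
  · exact (isConicalJunta_of_nonneg hfη0).mono hn
  have hn' : 4 * d + 1 ≤ n := by omega
  rcases Nat.eq_zero_or_pos d with hd0 | hdpos
  · -- `d = 0`: `f` is constant, `f + η` a non-negative constant
    subst hd0
    have hconst : (fun x => f x + η) = fun _ => cubeFourierCoeff f ∅ + η :=
      funext fun x => by rw [eq_const_of_hasDegreeLE_zero hdeg x]
    rw [hconst]
    refine isConicalJunta_const_of_nonneg _ ?_
    have := hfη0 (fun _ => false)
    rwa [eq_const_of_hasDegreeLE_zero hdeg] at this
  · -- main case `d ≥ 1`, `n ≥ 4d + 1`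
    by_contra hnot
    obtain ⟨pE, hpE⟩ := exists_lt_of_not_isConicalJunta hnot
    obtain ⟨M, lam, C, h, err, hlam0, hlam1, hC, hh, herr0, herrδ, hrep⟩ := happ
    have hn0 : (0 : ℝ) < n := by exact_mod_cast (by omega : 0 < n)
    have hnε : (n : ℝ) * ε ≤ 1 / 2 := by
      have hn5 : (5 : ℝ) ≤ n := by exact_mod_cast (by omega : 5 ≤ n)
      have h1 : (n : ℝ) * ε ≤ (n : ℝ) * (1 / (n : ℝ) ^ 4) := mul_le_mul_of_nonneg_left hε.le hn0.le
      have h2 : (n : ℝ) * (1 / (n : ℝ) ^ 4) = 1 / (n : ℝ) ^ 3 := by field_simp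
      have h3 : 1 / (n : ℝ) ^ 3 ≤ 1 / 2 := by
        apply one_div_le_one_div_of_le (by norm_num)
        have h53 := pow_le_pow_left₀ (by norm_num : (0 : ℝ) ≤ 5) hn5 3
        norm_num at h53
        linarith
      linarith
    set N : ℝ := ((univ.filter (fun S : Finset (Fin n) => S.card ≤ 4 * d)).card : ℝ) with hN
    have hEf : pE.truncate.E f = pE.E f := pE.truncate_E_of_hasDegreeLE (hdeg.mono (by omega))
    have hfun : f = ∑ i, lam i • (fun x => C i x * (1 + h i x)) + err := by
      funext x
      rw [hrep x]
      simp only [Pi.add_apply, Finset.sum_apply, Pi.smul_apply, smul_eq_mul]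
    have hE : pE.truncate.E f =
        ∑ i, lam i * pE.truncate.E (fun x => C i x * (1 + h i x)) + pE.truncate.E err := by
      conv_lhs => rw [hfun]
      rw [map_add, map_sum]
      congr 1
      exact sum_congr rfl fun i _ => by rw [map_smul, smul_eq_mul]
    have hterm : ∀ i, -(2 * ((n : ℝ) * ε) ^ (3 * d + 1) * N) ≤
        pE.truncate.E (fun x => C i x * (1 + h i x)) := by
      intro i
      obtain ⟨I, α, hI, hCi⟩ := hC i
      rw [hCi]
      exact pE.truncate_E_conjunction_mul_ge hI α hε0 hnε (hh i)
    have herrE : -(δ * N) ≤ pE.truncate.E err := by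
      have h1 := pE.abs_truncate_E_le_cubeExpect_abs_mul_card err
      have habs : (fun x => |err x|) = err := funext fun x => abs_of_nonneg (herr0 x)
      rw [habs] at h1
      have hN0 : 0 ≤ N := by rw [hN]; positivity
      have h2 : cubeExpect err * N ≤ δ * N := mul_le_mul_of_nonneg_right herrδ hN0
      rw [hN] at h2
      linarith [neg_abs_le (pE.truncate.E err)]
    have hX0 : 0 ≤ 2 * ((n : ℝ) * ε) ^ (3 * d + 1) * N := by rw [hN]; positivity
    have hsum : -(2 * ((n : ℝ) * ε) ^ (3 * d + 1) * N) ≤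
        ∑ i, lam i * pE.truncate.E (fun x => C i x * (1 + h i x)) := by
      have hl0 : 0 ≤ ∑ i, lam i := sum_nonneg fun i _ => hlam0 i
      calc -(2 * ((n : ℝ) * ε) ^ (3 * d + 1) * N)
          ≤ (∑ i, lam i) * (-(2 * ((n : ℝ) * ε) ^ (3 * d + 1) * N)) := by nlinarith
        _ = ∑ i, lam i * (-(2 * ((n : ℝ) * ε) ^ (3 * d + 1) * N)) := by rw [Finset.sum_mul]
        _ ≤ _ := sum_le_sum fun i _ => mul_le_mul_of_nonneg_left (hterm i) (hlam0 i)
    have hδ0 : 0 ≤ δ := (cubeExpect_nonneg herr0).trans herrδ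
    have hNle : N ≤ 1 + (n : ℝ) ^ (4 * d) := by
      rw [hN, card_filter_card_le]
      exact_mod_cast sum_range_choose_le_one_add_pow n (4 * d)
    have hnum := KMR_lemma24_arith_half hdpos hn' hε0 hε hδ0 hδ (by rw [hN]; positivity) hNle
    have hge : -(N * (2 * ((n : ℝ) * ε) ^ (3 * d + 1) + δ)) ≤ pE.truncate.E f := by
      rw [hE]
      nlinarith [hsum, herrE]
    rw [hEf] at hge
    linarith

/-- Lemma 2.4 with the shift `1/(2n)`, as a `deg_+` statement. [cite: KothariMekaRaghavendra2017, Lemma 2.4 (§2.1; proof §4.2)] -/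
theorem nonnegDegree_add_le_of_isApproxConicalJunta {d : ℕ} {ε δ : ℝ} {f : (Fin n → Bool) → ℝ}
    (hf0 : ∀ x, 0 ≤ f x) (happ : IsApproxConicalJunta ε δ d f) (hε0 : 0 ≤ ε)
    (hε : ε < 1 / (n : ℝ) ^ 4) (hdeg : HasDegreeLE d f) (hδ : δ < 1 / (n : ℝ) ^ (8 * d))
    {η : ℝ} (hη : 1 / (2 * (n : ℝ)) ≤ η) : nonnegDegree (fun x => f x + η) ≤ 4 * d :=
  (isConicalJunta_iff_nonnegDegree_le fun x => add_nonneg (hf0 x) (le_trans (by positivity) hη)).1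
    (isConicalJunta_add_of_isApproxConicalJunta hf0 happ hε0 hε hdeg hδ hη)

/-! ### Product-form reweightings `Π_i (1 + c χ_i)` and decaying functions

Multiplying a representation `C·(1+h)` (conjunction times `1 +` decaying) by a product weight
`ρ_c(z) = Π_i (1 + c·(−1)^{z_i})` with `|c| ≤ κ` small gives again `a · C · (1 + h')` with `h'` decaying at
the slightly worse rate `(κ + ε)(1 + κε)ⁿ/(1 − τ)`, `τ = (1+κε)ⁿ − 1`, and `a ∈ [1 − τ, 1 + τ]`
(coefficientwise: `((1+h)ρ_c)^(S) = Σ_T (1+h)^(T) c^{|T ∆ S|}`, and `Σ_T ε^{|T|} κ^{|T ∆ S|} =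
(κ+ε)^{|S|}(1+κε)^{n−|S|}`). This is not in the paper: it is the bookkeeping that replaces the sentence
"`𝟙_z` is a density" of §4.1 (true for a balanced gadget) for the tree's literal gadget `ipGadget`, whose
uniform fibres have the product density `ρ_κ`, `κ = 1/(2^b − 1)` (file `NonnegativeRankConicalJuntas.lean`).
[cite: KothariMekaRaghavendra2017, §4.1 (proof of Lemma 2.3) with Def. 2.1/2.2] -/

open scoped symmDiff

/-- The product weight `ρ_c(z) = Π_i (1 + c · (−1)^{z_i})` (`sgn true = −1`).
[cite: KothariMekaRaghavendra2017, §4.1 (the fibre density `𝟙_z` of the gadget, here for a biased gadget)] -/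
def biasProd (c : ℝ) (z : Fin n → Bool) : ℝ := ∏ i, (1 + c * sgn (z i))

/-- Walsh expansion of the product weight: `ρ_c = Σ_U c^{|U|} χ_U`. [cite: KothariMekaRaghavendra2017, §2.1 (Fourier expansion)] -/
theorem biasProd_eq_sum_walsh (c : ℝ) (z : Fin n → Bool) :
    biasProd c z = ∑ U : Finset (Fin n), c ^ U.card * walsh U z := by
  unfold biasProd
  rw [Finset.prod_one_add, Finset.powerset_univ]
  refine sum_congr rfl fun U _ => ?_
  rw [Finset.prod_mul_distrib, Finset.prod_const]
  rfl

/-- The Walsh coefficients of the product weight: `ρ̂_c(U) = c^{|U|}`. [cite: KothariMekaRaghavendra2017, §2.1 (Fourier expansion)] -/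
theorem cubeFourierCoeff_biasProd (c : ℝ) (U : Finset (Fin n)) :
    cubeFourierCoeff (biasProd (n := n) c) U = c ^ U.card := by
  have h := cubeFourierCoeff_sum_walsh (univ : Finset (Finset (Fin n))) (fun U => c ^ U.card) U
  simp only [mem_univ, if_true] at h
  rw [← h]
  congr 1
  funext z
  rw [biasProd_eq_sum_walsh]

/-- `ρ_c · ρ_{−c} = (1 − c²)ⁿ` pointwise (so `1/ρ_c = ρ_{−c}/(1−c²)ⁿ`). [cite: KothariMekaRaghavendra2017, §4.1] -/
theorem biasProd_mul_biasProd_neg (c : ℝ) (z : Fin n → Bool) :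
    biasProd c z * biasProd (-c) z = (1 - c ^ 2) ^ n := by
  unfold biasProd
  rw [← Finset.prod_mul_distrib]
  have : ∀ i, (1 + c * sgn (z i)) * (1 + -c * sgn (z i)) = 1 - c ^ 2 := by
    intro i
    have hs : sgn (z i) * sgn (z i) = 1 := Literature.Probability.RandomGraphs.LowDegree.sgn_mul_self _
    linear_combination (-(c ^ 2)) * hs
  simp_rw [this]
  rw [Finset.prod_const, Finset.card_univ, Fintype.card_fin]

/-- Upper bound `ρ_c ≤ (1 + |c|)ⁿ` for `|c| ≤ 1`. [cite: KothariMekaRaghavendra2017, §4.1] -/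
theorem biasProd_le {c : ℝ} (hc : |c| ≤ 1) (z : Fin n → Bool) : biasProd c z ≤ (1 + |c|) ^ n := by
  unfold biasProd
  calc ∏ i, (1 + c * sgn (z i)) ≤ ∏ _i : Fin n, (1 + |c|) := by
        refine Finset.prod_le_prod (fun i _ => ?_) fun i _ => ?_
        · cases z i <;> simp [sgn] <;> linarith [abs_nonneg c, neg_abs_le c, le_abs_self c]
        · cases z i <;> simp [sgn] <;> linarith [neg_abs_le c, le_abs_self c]
    _ = (1 + |c|) ^ n := by rw [Finset.prod_const, Finset.card_univ, Fintype.card_fin]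

/-- Lower bound `(1 − |c|)ⁿ ≤ ρ_c` for `|c| ≤ 1`. [cite: KothariMekaRaghavendra2017, §4.1] -/
theorem le_biasProd {c : ℝ} (hc : |c| ≤ 1) (z : Fin n → Bool) : (1 - |c|) ^ n ≤ biasProd c z := by
  unfold biasProd
  calc (1 - |c|) ^ n = ∏ _i : Fin n, (1 - |c|) := by rw [Finset.prod_const, Finset.card_univ, Fintype.card_fin]
    _ ≤ ∏ i, (1 + c * sgn (z i)) := by
        refine Finset.prod_le_prod (fun i _ => by linarith) fun i _ => ?_
        cases z i <;> simp [sgn] <;> linarith [neg_abs_le c, le_abs_self c]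

/-- `ρ_c > 0` for `|c| < 1`. [cite: KothariMekaRaghavendra2017, §4.1] -/
theorem biasProd_pos {c : ℝ} (hc : |c| < 1) (z : Fin n → Bool) : 0 < biasProd c z :=
  lt_of_lt_of_le (pow_pos (by linarith) n) (le_biasProd hc.le z)

/-- The subset sum `Σ_T ε^{|T|} κ^{|T ∆ S|} = (κ + ε)^{|S|} (1 + εκ)^{n − |S|}` (coordinatewise
factorisation). [cite: KothariMekaRaghavendra2017, §2.1 (Fourier bookkeeping)] -/
theorem sum_pow_card_mul_pow_card_symmDiff (ε κ : ℝ) (S : Finset (Fin n)) :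
    ∑ T : Finset (Fin n), ε ^ T.card * κ ^ (T ∆ S).card =
      (ε + κ) ^ S.card * (ε * κ + 1) ^ (n - S.card) := by
  classical
  -- `Π_i (u_i + v_i)` with `u_i = ε` or `εκ`, `v_i = κ` or `1` according to `i ∈ S`
  have hprod := Finset.prod_add (fun i : Fin n => if i ∈ S then ε else ε * κ)
    (fun i => if i ∈ S then κ else (1 : ℝ)) univ
  have lhs : ∏ i : Fin n, ((if i ∈ S then ε else ε * κ) + (if i ∈ S then κ else (1 : ℝ))) =
      (ε + κ) ^ S.card * (ε * κ + 1) ^ (n - S.card) := by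
    rw [← Finset.prod_filter_mul_prod_filter_not univ (fun i => i ∈ S)]
    have e1 : univ.filter (fun i : Fin n => i ∈ S) = S := by ext i; simp
    have e2 : (univ.filter (fun i : Fin n => ¬ i ∈ S)).card = n - S.card := by
      have := Finset.card_filter_add_card_filter_not (s := (univ : Finset (Fin n))) (fun i => i ∈ S)
      rw [e1, Finset.card_univ, Fintype.card_fin] at this
      omega
    rw [Finset.prod_congr rfl (fun i hi => by rw [if_pos (mem_filter.1 hi).2, if_pos (mem_filter.1 hi).2]),
      Finset.prod_const, e1,
      Finset.prod_congr rfl (fun i hi => by rw [if_neg (mem_filter.1 hi).2, if_neg (mem_filter.1 hi).2]),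
      Finset.prod_const, e2]
  rw [lhs, Finset.powerset_univ] at hprod
  rw [hprod]
  refine sum_congr rfl fun T _ => ?_
  -- `Π_{i∈T} u_i = ε^{|T ∩ S|} (εκ)^{|T \ S|}`, `Π_{i∉T} v_i = κ^{|S \ T|}`
  have p1 : ∏ i ∈ T, (if i ∈ S then ε else ε * κ) = ε ^ (T ∩ S).card * (ε * κ) ^ (T \ S).card := by
    rw [Finset.prod_ite, Finset.prod_const, Finset.prod_const]
    congr 2
    congr 1; ext i; simp only [mem_filter, mem_sdiff]
  have p2 : ∏ i ∈ univ \ T, (if i ∈ S then κ else (1 : ℝ)) = κ ^ (S \ T).card := by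
    rw [Finset.prod_ite, Finset.prod_const, Finset.prod_const, one_pow, mul_one]
    congr 1; congr 1; ext i; simp [mem_sdiff, and_comm]
  have c1 : (T ∩ S).card + (T \ S).card = T.card := Finset.card_inter_add_card_sdiff T S
  have c4 : (T ∆ S).card = (T \ S).card + (S \ T).card := by
    rw [symmDiff_def, sup_eq_union, Finset.card_union_of_disjoint (disjoint_sdiff_sdiff)]
  rw [p1, p2, c4, ← c1, pow_add, pow_add, mul_pow]
  ring

/-- **Reweighting a decaying perturbation of `1`.** If `E h = 0`, `|ĥ(S)| ≤ ε^{|S|}`, `|c| ≤ κ` and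
`τ = (1+κε)ⁿ − 1 < 1`, then `(1 + h)·ρ_c = a·(1 + h')` with `1 − τ ≤ a ≤ 1 + τ` and `h'`
`ε'`-decaying for `ε' = (κ + ε)(1+κε)ⁿ/(1 − τ)`. [cite: KothariMekaRaghavendra2017, Def. 2.1 with §4.1 (repair of "𝟙_z is a density" for the literal gadget)] -/
theorem exists_isDecaying_one_add_mul_biasProd {ε κ c : ℝ} (hε0 : 0 ≤ ε) (hκ0 : 0 ≤ κ) (hc : |c| ≤ κ)
    {h : (Fin n → Bool) → ℝ} (hh : IsDecaying ε h) (hτ : (1 + κ * ε) ^ n - 1 < 1) :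
    ∃ (a : ℝ) (h' : (Fin n → Bool) → ℝ), (1 - ((1 + κ * ε) ^ n - 1) ≤ a ∧ a ≤ 1 + ((1 + κ * ε) ^ n - 1)) ∧
      IsDecaying ((κ + ε) * (1 + κ * ε) ^ n / (1 - ((1 + κ * ε) ^ n - 1))) h' ∧
      ∀ z, (1 + h z) * biasProd c z = a * (1 + h' z) := by
  classical
  set τ : ℝ := (1 + κ * ε) ^ n - 1 with hτdef
  set g : (Fin n → Bool) → ℝ := fun z => (1 + h z) * biasProd c z with hg
  -- coefficients of `1 + h`
  have h1h : ∀ T : Finset (Fin n), cubeFourierCoeff (fun z => 1 + h z) T = (if T = ∅ then 1 else 0) + cubeFourierCoeff h T := by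
    intro T
    rw [Literature.Computability.Complexity.LowDegree.cubeFourierCoeff_add]
    congr 1
    by_cases hT : T = ∅
    · subst hT
      rw [if_pos rfl, cubeFourierCoeff_empty]
      simp
    · rw [if_neg hT, Literature.Computability.Complexity.LowDegree.cubeFourierCoeff_const hT]
  have hh0 : cubeFourierCoeff h ∅ = 0 := by
    rw [cubeFourierCoeff_empty]; exact hh.1
  have habs1h : ∀ T : Finset (Fin n), |cubeFourierCoeff (fun z => 1 + h z) T| ≤ ε ^ T.card := by
    intro T
    rw [h1h T]
    by_cases hT : T = ∅
    · subst hT; rw [if_pos rfl, hh0]; simp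
    · rw [if_neg hT, zero_add]; exact hh.2 T
  -- coefficients of `g`
  have hgco : ∀ S : Finset (Fin n), cubeFourierCoeff g S =
      ∑ T, cubeFourierCoeff (fun z => 1 + h z) T * c ^ (T ∆ S).card := by
    intro S
    rw [hg, Literature.Computability.Complexity.LowDegree.cubeFourierCoeff_mul]
    exact sum_congr rfl fun T _ => by rw [cubeFourierCoeff_biasProd]
  have hκε0 : 0 ≤ κ * ε := mul_nonneg hκ0 hε0
  have hF1 : 1 ≤ (1 + κ * ε) ^ n := one_le_pow₀ (by linarith)
  -- `|ĝ(S)| ≤ (κ+ε)^{|S|} (1+κε)^n`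
  have hgabs : ∀ S : Finset (Fin n), |cubeFourierCoeff g S| ≤ (κ + ε) ^ S.card * (1 + κ * ε) ^ n := by
    intro S
    rw [hgco S]
    calc |∑ T, cubeFourierCoeff (fun z => 1 + h z) T * c ^ (T ∆ S).card|
        ≤ ∑ T, |cubeFourierCoeff (fun z => 1 + h z) T * c ^ (T ∆ S).card| := abs_sum_le_sum_abs _ _
      _ ≤ ∑ T : Finset (Fin n), ε ^ T.card * κ ^ (T ∆ S).card := by
          refine sum_le_sum fun T _ => ?_
          rw [abs_mul, abs_pow]
          exact mul_le_mul (habs1h T) (pow_le_pow_left₀ (abs_nonneg c) hc _) (by positivity) (by positivity)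
      _ = (ε + κ) ^ S.card * (ε * κ + 1) ^ (n - S.card) := sum_pow_card_mul_pow_card_symmDiff ε κ S
      _ ≤ (κ + ε) ^ S.card * (1 + κ * ε) ^ n := by
          rw [add_comm ε κ, mul_comm ε κ, add_comm (κ * ε) 1]
          exact mul_le_mul_of_nonneg_left (pow_le_pow_right₀ (by linarith) (Nat.sub_le _ _)) (by positivity)
  -- `|ĝ(∅) − 1| ≤ τ`
  have hg0 : |cubeFourierCoeff g ∅ - 1| ≤ τ := by
    rw [hgco ∅]
    have hsplit : ∑ T, cubeFourierCoeff (fun z => 1 + h z) T * c ^ (T ∆ ∅).card - 1 =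
        ∑ T, cubeFourierCoeff h T * c ^ T.card := by
      have e : ∀ T : Finset (Fin n), cubeFourierCoeff (fun z => 1 + h z) T * c ^ (T ∆ ∅).card =
          (if T = ∅ then 1 else 0) + cubeFourierCoeff h T * c ^ T.card := by
        intro T
        rw [h1h T, show T ∆ (∅ : Finset (Fin n)) = T by rw [← Finset.bot_eq_empty]; exact symmDiff_bot T]
        by_cases hT : T = ∅
        · subst hT; simp [hh0]
        · rw [if_neg hT, zero_add, zero_add]
      simp_rw [e]
      rw [Finset.sum_add_distrib, Finset.sum_ite_eq' univ (∅ : Finset (Fin n))]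
      simp
    rw [hsplit]
    calc |∑ T, cubeFourierCoeff h T * c ^ T.card| ≤ ∑ T, |cubeFourierCoeff h T * c ^ T.card| :=
          abs_sum_le_sum_abs _ _
      _ ≤ ∑ T : Finset (Fin n), (if T = ∅ then 0 else (ε * κ) ^ T.card) := by
          refine sum_le_sum fun T _ => ?_
          by_cases hT : T = ∅
          · subst hT; simp [hh0]
          · rw [if_neg hT, abs_mul, abs_pow, mul_pow]
            exact mul_le_mul (hh.2 T) (pow_le_pow_left₀ (abs_nonneg c) hc _) (by positivity) (by positivity)
      _ = ∑ T : Finset (Fin n), (ε * κ) ^ T.card - 1 := by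
          rw [Finset.sum_ite, Finset.sum_const_zero, zero_add]
          have : ∑ T : Finset (Fin n), (ε * κ) ^ T.card =
              ∑ T ∈ univ.filter (fun T : Finset (Fin n) => ¬ T = ∅), (ε * κ) ^ T.card + 1 := by
            rw [← Finset.sum_filter_add_sum_filter_not univ (fun T : Finset (Fin n) => T = ∅)]
            rw [Finset.filter_eq' univ (∅ : Finset (Fin n))]
            simp [add_comm]
          linarith
      _ = τ := by
          rw [hτdef]
          have := Fintype.sum_pow_mul_eq_add_pow (Finset (Fin n) |> fun _ => Fin n) (ε * κ) (1 : ℝ)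
          simp only [one_pow, mul_one, Fintype.card_fin] at this
          rw [this]; ring
  -- the normalising constant `a = ĝ(∅)` and `h' = g/a − 1`
  have hτ0 : 0 ≤ τ := by rw [hτdef]; linarith
  have ha_lo : 1 - τ ≤ cubeFourierCoeff g ∅ := by linarith [(abs_le.1 hg0).1]
  have ha_hi : cubeFourierCoeff g ∅ ≤ 1 + τ := by linarith [(abs_le.1 hg0).2]
  have ha0 : 0 < cubeFourierCoeff g ∅ := lt_of_lt_of_le (by linarith) ha_lo
  set a := cubeFourierCoeff g ∅ with ha
  -- coefficients of `h' = g/a − 1`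
  have hone : cubeFourierCoeff (fun _ : Fin n → Bool => (1 : ℝ)) ∅ = 1 := by
    rw [cubeFourierCoeff_empty, Finset.sum_const, Finset.card_univ, Fintype.card_fun, Fintype.card_bool,
      Fintype.card_fin, nsmul_eq_mul, mul_one]
    push_cast
    exact div_self (by positivity)
  have hco' : ∀ S : Finset (Fin n), cubeFourierCoeff (fun z => g z / a - 1) S =
      a⁻¹ * cubeFourierCoeff g S - cubeFourierCoeff (fun _ : Fin n → Bool => (1 : ℝ)) S := by
    intro S
    have : (fun z => g z / a - 1) = fun z => a⁻¹ * g z - (fun _ : Fin n → Bool => (1 : ℝ)) z :=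
      funext fun z => by simp only [div_eq_inv_mul]
    rw [this, Literature.Computability.Complexity.LowDegree.cubeFourierCoeff_sub,
      Literature.Computability.Complexity.LowDegree.cubeFourierCoeff_const_mul]
  refine ⟨a, fun z => g z / a - 1, ⟨ha_lo, ha_hi⟩, ⟨?_, fun S => ?_⟩, fun z => ?_⟩
  · -- `E h' = ĝ(∅)/a − 1 = 0`
    have e : cubeExpect (fun z => g z / a - 1) = cubeFourierCoeff (fun z => g z / a - 1) ∅ := by
      rw [cubeFourierCoeff_empty]; rfl
    rw [e, hco' ∅, hone, ← ha, inv_mul_cancel₀ ha0.ne', sub_self]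
  · -- `|ĥ'(S)| ≤ ε'^{|S|}`
    by_cases hS : S = ∅
    · subst hS
      rw [hco' ∅, hone, ← ha, inv_mul_cancel₀ ha0.ne', sub_self, abs_zero]
      positivity
    · have e : cubeFourierCoeff (fun z => g z / a - 1) S = cubeFourierCoeff g S / a := by
        rw [hco' S, Literature.Computability.Complexity.LowDegree.cubeFourierCoeff_const hS, sub_zero,
          div_eq_inv_mul]
      rw [e, abs_div, abs_of_pos ha0]
      have hS1 : 1 ≤ S.card := Finset.one_le_card.2 (Finset.nonempty_iff_ne_empty.2 hS)
      have hF : 1 ≤ (1 + κ * ε) ^ n / (1 - τ) := by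
        rw [le_div_iff₀ (by linarith)]; linarith
      calc |cubeFourierCoeff g S| / a ≤ (κ + ε) ^ S.card * (1 + κ * ε) ^ n / (1 - τ) := by
            rw [div_le_div_iff₀ ha0 (by linarith)]
            calc |cubeFourierCoeff g S| * (1 - τ) ≤ (κ + ε) ^ S.card * (1 + κ * ε) ^ n * (1 - τ) :=
                  mul_le_mul_of_nonneg_right (hgabs S) (by linarith)
              _ ≤ (κ + ε) ^ S.card * (1 + κ * ε) ^ n * a :=
                  mul_le_mul_of_nonneg_left ha_lo (by positivity)
        _ = (κ + ε) ^ S.card * ((1 + κ * ε) ^ n / (1 - τ)) := by ring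
        _ ≤ (κ + ε) ^ S.card * ((1 + κ * ε) ^ n / (1 - τ)) ^ S.card :=
            mul_le_mul_of_nonneg_left (le_self_pow₀ hF (by omega)) (by positivity)
        _ = ((κ + ε) * (1 + κ * ε) ^ n / (1 - τ)) ^ S.card := by rw [← mul_pow]; ring
  · -- `(1 + h)ρ = a (1 + h')`
    show g z = a * (1 + (g z / a - 1))
    field_simp
    ring

/-- **Reweighting an approximate conical junta by `ρ_c`, `|c| ≤ κ < 1`.** If `g` is an
`(ε, δ)`-approximate conical `d`-junta and `τ = (1+κε)ⁿ − 1 < 1`, then `g·ρ_c/(1+τ)` is an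
`(ε', (1+κ)ⁿ δ)`-approximate conical `d`-junta, `ε' = (κ+ε)(1+κε)ⁿ/(1−τ)`: each piece `C(1+h)ρ_c = a C (1+h')`
by `exists_isDecaying_one_add_mul_biasProd` (weights `λ a/(1+τ) ≤ λ`), and the error `γ ρ_c/(1+τ)` has mean
`≤ (1+κ)ⁿ E γ`. [cite: KothariMekaRaghavendra2017, Def. 2.2 with §4.1 (repair for the literal gadget)] -/
theorem IsApproxConicalJunta.mul_biasProd {ε δ κ c : ℝ} {d : ℕ} {g : (Fin n → Bool) → ℝ}
    (hg : IsApproxConicalJunta ε δ d g) (hε0 : 0 ≤ ε) (hκ0 : 0 ≤ κ) (hκ1 : κ < 1) (hc : |c| ≤ κ)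
    (hτ : (1 + κ * ε) ^ n - 1 < 1) :
    IsApproxConicalJunta ((κ + ε) * (1 + κ * ε) ^ n / (1 - ((1 + κ * ε) ^ n - 1))) ((1 + κ) ^ n * δ) d
      (fun z => g z * biasProd c z / (1 + ((1 + κ * ε) ^ n - 1))) := by
  classical
  set τ : ℝ := (1 + κ * ε) ^ n - 1 with hτdef
  obtain ⟨N, lam, C, h, γ, hlam0, hlam1, hC, hh, hγ0, hγ, hrep⟩ := hg
  have hpieces : ∀ i, ∃ (a : ℝ) (h' : (Fin n → Bool) → ℝ), (1 - τ ≤ a ∧ a ≤ 1 + τ) ∧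
      IsDecaying ((κ + ε) * (1 + κ * ε) ^ n / (1 - τ)) h' ∧
      ∀ z, (1 + h i z) * biasProd c z = a * (1 + h' z) :=
    fun i => exists_isDecaying_one_add_mul_biasProd hε0 hκ0 hc (hh i) hτ
  choose a h' ha hh' hrep' using hpieces
  have hτ0 : 0 ≤ τ := by
    rw [hτdef]; linarith [one_le_pow₀ (by nlinarith : (1 : ℝ) ≤ 1 + κ * ε) (n := n)]
  have h1τ : 0 < 1 + τ := by linarith
  have hc1 : |c| < 1 := lt_of_le_of_lt hc hκ1
  have hρ0 : ∀ z : Fin n → Bool, 0 ≤ biasProd c z := fun z => (biasProd_pos hc1 z).le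
  have hρle : ∀ z : Fin n → Bool, biasProd c z ≤ (1 + κ) ^ n := fun z =>
    (biasProd_le hc1.le z).trans (pow_le_pow_left₀ (by positivity) (by linarith) n)
  have hδ0 : 0 ≤ δ := (cubeExpect_nonneg hγ0).trans hγ
  refine ⟨N, fun i => lam i * a i / (1 + τ), C, h', fun z => γ z * biasProd c z / (1 + τ),
    fun i => div_nonneg (mul_nonneg (hlam0 i) (by linarith [(ha i).1])) h1τ.le, ?_, hC, hh',
    fun z => div_nonneg (mul_nonneg (hγ0 z) (hρ0 z)) h1τ.le, ?_, fun z => ?_⟩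
  · -- weights: `Σ λ_i a_i/(1+τ) ≤ Σ λ_i ≤ 1`
    calc ∑ i, lam i * a i / (1 + τ) ≤ ∑ i, lam i := by
          refine sum_le_sum fun i _ => ?_
          rw [div_le_iff₀ h1τ]
          exact mul_le_mul_of_nonneg_left (ha i).2 (hlam0 i)
      _ ≤ 1 := hlam1
  · -- error: `E[γ ρ/(1+τ)] ≤ (1+κ)^n E γ`
    calc cubeExpect (fun z => γ z * biasProd c z / (1 + τ))
        ≤ cubeExpect (fun z => (1 + κ) ^ n * γ z) := by
          refine cubeExpect_mono fun z => ?_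
          rw [div_le_iff₀ h1τ]
          calc γ z * biasProd c z ≤ γ z * (1 + κ) ^ n := mul_le_mul_of_nonneg_left (hρle z) (hγ0 z)
            _ = (1 + κ) ^ n * γ z * 1 := by ring
            _ ≤ (1 + κ) ^ n * γ z * (1 + τ) :=
                mul_le_mul_of_nonneg_left (by linarith) (mul_nonneg (by positivity) (hγ0 z))
      _ = (1 + κ) ^ n * cubeExpect γ := cubeExpect_const_mul _ _
      _ ≤ (1 + κ) ^ n * δ := mul_le_mul_of_nonneg_left hγ (by positivity)
  · -- the identity
    show g z * biasProd c z / (1 + τ) =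
      ∑ i, lam i * a i / (1 + τ) * (C i z * (1 + h' i z)) + γ z * biasProd c z / (1 + τ)
    rw [hrep z, add_mul, Finset.sum_mul, add_div, Finset.sum_div]
    congr 1
    refine sum_congr rfl fun i _ => ?_
    have e := hrep' i z
    calc lam i * (C i z * (1 + h i z)) * biasProd c z / (1 + τ)
        = lam i * C i z * ((1 + h i z) * biasProd c z) / (1 + τ) := by ring
      _ = lam i * C i z * (a i * (1 + h' i z)) / (1 + τ) := by rw [e]
      _ = lam i * a i / (1 + τ) * (C i z * (1 + h' i z)) := by ring

end Literature.Combinatorics.Optimization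

end
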